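import Summits.NavierStokesRegularity.NavierStokesRegularity.Theses.SymmetryModuliCount
import Summits.NavierStokesRegularity.NavierStokesRegularity.Theorems.MustSqueeze.Negative.ConstantsKNSSMild
import Summits.NavierStokesRegularity.NavierStokesRegularity.Theorems.SqueezeCycleExtremalBiaxialitySubcriticalSmallConstant

/-!
# Disproof of `ForcedSymmetry` (crux stmt-NavierStokesRegularity-4052, route SymmetryModuliCount) — findings

WORK FILE of the standing crux disprover (cdisprove, D-0016), v9 (cycle 2).  Prose only in docstrings.
Landed companions (importable): `Theorems/ForcedSymmetry/Negative/{Witness, WithoutOseen, Criterion}.lean`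
(p73155, p74811, p76645 — §1–§7 below), `Negative/{Census, VertexOutsideEnd, DSSWitness}.lean` (§8, §10, this cycle; proposals pending),
and the drefute seat's `Negative/TimeAnchorStubs.lean` (stub mutations of the picked line, pending).

* §1 READ-BACK. `ForcedSymmetry ↔ ∀ C u, InClassA C u → HasSimSymmetry u` (`Iff.rfl`), where
  `InClassA C u := H1 u ∧ H2 u ∧ H3 u ∧ H4 C u` are VERBATIM the four clauses of the sister crux
  `MustSqueeze` (`Theorems/MustSqueeze/Negative/WithoutOseen.lean`: the written-out Oseen integrand there
  is `oseenKernel (t-τ) (x-y) (u τ y) (u τ y)` by `rfl`), so that file's toolkit is reused.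
* §2 DEGENERATE INSTANCES HOLD (no junk refutation): `C ≤ 0` (class is `{0}` / empty), the zero field
  (in the class for `C ≥ 0`, symmetric under every `ξ`), constants (in the class MINUS H4, and
  translation-invariant).  AMENDED v7: dropping H4 (the Type-I rate) DOES make the statement false ON
  PAPER — `u = e^{−t}B`, `B` the ABC Beltrami field (`curl B = B`, `ΔB = −B`), is smooth, divergence
  free, KNSS-mild (`e^{τΔ}B = e^{−τ}B`, Duhamel term `e^{τΔ}P∇(|B|²/2) = 0`) and has trivial
  stabiliser, while `‖u‖ = e^{−t}‖B‖` violates H4; the typed witness is deferred (it needs the heat flow of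
  trigonometric fields and the Oseen integral of a periodic Beltrami tensor in the tree's kernel form —
  the tree's cheap Oseen toolkit only covers unidirectional fields, which are symmetric, §8).  What DOES
  follow from the KNSS Liouville conjecture (L) is the variant with H4 replaced by mere boundedness.
* §3 LOAD-BEARING H3 (the Oseen/NS identity): `forcedSymmetry_false_without_H3` — an explicit smooth,
  divergence-free field with the Type-I rate and NO nonzero infinitesimal similarity symmetry.
* §3b DRIFT CLASS: the same witness obeys `‖∇w‖ ≤ 7/(−t)`; `not_forcedSymmetryOnDriftClass` — symmetry is
  not forced on general Type-I drifts (the hypothesis class of `FiniteTangentModuliMild`, stmt-14049).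
* §4 WHY IT RESISTS: any counterexample to the crux is a NONZERO element of `A_C`, i.e. a nontrivial
  Type-I KNSS-mild ancient solution — the open Type-I Liouville problem (KNSS2009 §6; BradshawTsai2017 OP 5.1);
  `X → ForcedSymmetry` is recorded (`forcedSymmetry_of_typeIAncientLiouville`), and the dichotomy is EXACT:
  `X ⇔ FS ∧ SymmetricLiouville` (`typeIAncientLiouville_iff_forced_and_symmetric`).  Known explicit unsteady
  families are all excluded from `A_C ∖ {0}`: constants / parasitic `b(t)` / potential flows (gauge H3 +
  H4), Beltrami `e^{−k²t}B` (backward growth), shear and 2.5-D flows (KNSS Thm 5.1 + caloric Liouville —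
  and they are symmetric anyway, §8), backward self-similar (symmetric anyway; Tsai), backward DSS
  (existence open).
* §5 BOUNDARY: `A_C = {0}` for `C ≤ ε` (tree theorem `exists_typeIAncientMild_eq_zero_of_small`, reused via
  `inClassA_iff_isTypeIAncientMild`): the crux is trivially TRUE in the perturbative regime; its content
  sits at large `C`.
* §6 MODELLING REMARK (planner): the typed `sim(3)` pins the blow-up time at `0`; the full point-symmetry
  algebra of the ancient class has an 8th generator `θ∂_t` (`simGen8`, `HasSimSymmetry8`) — vindicated by
  the picked line, whose hardest stub re-anchors the crux in `⟨∂ₜ⟩ ⊕ sim(3)`; the pure time shift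
  stabilises only `0` (`vanishes_of_steady`).
* §7 REFUTATION CRITERION: `¬FS ↔ ∃ C u, InClassA C u ∧ TrivialStabiliser u`; any counterexample is
  nonzero, has `C > ε`, and refutes `X` (`not_forcedSymmetry_witness`).
* §8 TARGETS — line `time-anchor-bootstrap` (PICKED; skeleton 23c958e3…, stubs 1 `extendedForcedSymmetry`,
  2a/2b `futureVertexLiouville{Irrotational,Rotated}`, 3 `interiorVertexVanishing`, 4 `rigidComotionVanishing`).
  Verdicts: 3 and 4 PROVED (p76364, p76798); 2a TRUE on paper (Euler homogeneity ⇒ bounded backward Leray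
  profile ⇒ `tsai_selfsimilar_bounded_holds` ⇒ constant slices ⇒ gauge); 2b OPEN = bounded-profile backward
  RSS Liouville (PineauVicol2026 Thm 1.4 needs profile decay and `|α| ≪ 1` or `≫ 1`; `α ∼ 1` is their
  Conj. 1.1); 1 ⇔ crux (skeleton `forcedSymmetry_iff_extended`).  Mutations by the drefute seat
  (`TimeAnchorStubs.lean`): 4 false without H4 (constants), 2a/2b false without H3 (parasitic future-vertex
  soliton), 1 false without H3 (`w` has trivial EXTENDED stabiliser).  NEW HERE (kernel-checked):
  `vertexOutsideEnd_false_without_H3` — stub 3's side condition `θ ≤ T` is NECESSARY in the H3-free class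
  (glued parasitic soliton `vtxWit`: the elementary vertex lemma cannot reach vertices in `(T, 0)`; there the
  Oseen clause must enter — Tsai + gauge on the end for `A = 0`, open RSS-Liouville for `A ≠ 0`); census
  lemmas `hasSimSymmetry_of_translation_invariant / _of_indep_coord / _of_axisymmetric` — coordinate-independent
  (shear, unidirectional, 2.5-D) and axisymmetric (hence helical, same proof) fields satisfy the CONCLUSION of
  the crux by definition, so none of them can ever refute it, in any class: a refutation needs a field with no
  continuous Euclidean/similarity symmetry at all (this is also why the tree's Oseen line-integral toolkit
  `integral_oseenKernel_sub_smul_single_left`, valid for unidirectional fields only, cannot manufacture the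
  drop-H4 witness of §2).
* §9 PAPER REMARKS (not kernel-checked; for planner/lead): (i) H2 is implied by H1 + H3 + H4 (the
  Oseen–Duhamel output is divergence free, and `div e^{(t−s)Δ}u(s) → 0` as `s → −∞` since
  `‖∇e^{τΔ}f‖∞ ≲ τ^{-1/2}‖f‖∞` and `‖u(s)‖∞ ≤ C/√(−s)`) — "H2 possibly unnecessary", information only;
  (ii) the FORWARD-IN-TIME analogue of the crux is FALSE by known theorems: small λ-DSS data in `BMO⁻¹`
  with no continuous symmetry (`u₀ = ε curl(m(log|x|)Φ(x/|x|))`, `m` log-periodic) generate Koch–Tataru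
  solutions, smooth and KNSS-mild on `t > 0` with `‖u(t)‖∞ ≤ Cε/√t`, λ-DSS by uniqueness, generically with
  trivial connected stabiliser — so ANCIENTNESS, not Type-I + mildness, is the load-bearing direction, and
  discrete self-similarity does not force a continuous symmetry; (iii) THREAT MODEL after the time-anchor
  collapse: a kill of the crux is EITHER a nonzero member with trivial extended stabiliser (a backward
  λ-DSS non-RSS profile — BradshawTsai2017 OP 5.1; ChaeWolf2017 removes only `λ ≈ 1`) OR a nonzero
  bounded-profile backward RSS member `v` (PineauVicol2026 Conj. 1.1 at `α ∼ 1`): its backward time-shift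
  `v(·−θ)` is again in `A_C` and has trivial `sim(3)`-stabiliser (two scaling generators with different
  vertices combine by `extGen_combine` to a rigid co-motion, lethal by stub 4, or to a Killing field) unless
  the profile carries an extra Killing symmetry; (iv) WHY SYMMETRY-FORCING IS PLAUSIBLE ELSEWHERE BUT
  UNSUPPORTED HERE: every known "Type I ⇒ (asymptotically) self-similar" theorem rests on a scale-invariant
  MONOTONICITY formula (Giga–Kohn weighted energy for `u_t = Δu + |u|^{p−1}u`, Huisken's Gaussian density
  for MCF, Struwe's for the harmonic map heat flow, Perelman's entropy for Ricci flow); 3-D Navier–Stokes has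
  no known monotone scale-invariant quantity (supercritical energy), and the two unpicked lines
  (far-past-energy-ledger, blow-down-census) try to substitute Albritton–Barker persistence + the local
  energy class for it.  Where no monotonicity is available, scale-invariant PDE DO carry regular solutions
  that are discretely but NOT continuously self-similar: the Choptuik critical solution of the spherically
  symmetric Einstein–massless-scalar system is DSS with echoing period `Δ = 3.4453 ± 0.0005` and is not CSS
  (Gundlach, Phys. Rev. D 55 (1997) 695, "Understanding critical collapse of a scalar field" — constructed
  as a regular DSS solution; hyperbolic, found via `lit galaxy`).  So "DSS without CSS at the Type-I
  rate" is a consistent scenario in a scale-invariant evolution equation; nothing NS-specific in print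
  excludes it backward in time except Chae–Wolf 2017 for `λ ≈ 1`; (v) PRIMARY-SOURCE CHECK of the RSS leaf
  (Pineau–Vicol arXiv:2607.09619, pp. 3–4, materialised this cycle): their Conjecture 1.1 (= Perelman's
  conjecture, Tsai 2018 Conj. 8.9, Bradshaw–Tsai OP 5.2) assumes the DECAYING profile bound
  `|U(y)| ≤ C/(1+|y|)`, equivalent to the space–time Type-I rate `|u| ≤ C/(|x| + √(−t))` (their (1.10));
  Theorem 1.4 settles it for `|α| < α₋(C)` and `|α| > α₊(C)` only, and for `α ≈ 1` "no α-dependent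
  modification of the Bernoulli/head-pressure quantity with a maximum principle is known" (p. 4) — the
  same missing-monotone-quantity obstruction as (iv).  The crux's class carries only the TEMPORAL rate
  `|u| ≤ C/√(−t)`, i.e. a merely BOUNDED profile `|U| ≤ C`: the RSS leaf met here (stub 2b; the sibling
  crux's RSS leaf) is therefore STRONGER than Conjecture 1.1, and a counterexample to Conjecture 1.1 at
  `α ≈ 1` would already (via its backward time-shift, (iii)) refute `ForcedSymmetry` itself.
* §10 DISCRETE SELF-SIMILARITY DOES NOT FORCE A CONTINUOUS SYMMETRY (kinematically; kernel-checked): the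
  λ-DSS field `ud t x = (2 + sin log(−t)) (−t)^{-1/2} V(x/√(−t))` (`λ = e^{π}`, `ud_dss`) is smooth on
  `t < 0`, divergence free, Type-I with `C = 6`, and has TRIVIAL `sim(3)`-stabiliser (`ud_rigid`: two
  slices with equal phase kill the translation part, the stationary-phase slice `t = −e^{π/2}` kills the
  rotational defect, `V e₀ ≠ 0` kills `σ`, then `rigid_of_R`) — `dss_does_not_force_symmetry`,
  `forcedSymmetry_false_without_H3'`.  This is the kinematic shadow of the real threat (a backward λ-DSS,
  non-RSS member of `A_C`, Bradshaw–Tsai 2017 OP 5.1): the typed side clauses plus discrete self-similarity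
  do not produce the crux's `∃ ξ`.  `coords_eq_zero_of_R` / `rigid_of_R` abstract the rigidity computation
  of §3 (`R a A ≡ 0`, `A` skew ⇒ `a = 0`, `A = 0`) for reuse with other clocks.  v9: even the EXTENDED
  stabiliser of `ud` in `⟨∂ₜ⟩ ⊕ sim(3)` is trivial (`ud_rigid8`, `ud_not_hasSimSymmetry8`: three equal-phase
  slices separate the `e^{−s/2}`, constant and `e^{−s}` modes; `DV e₀ e₀ ≠ 0` kills `τ`) — a discretely
  self-similar refutation of the drop-H3 version of the lead's hardest stub `stub_extendedForcedSymmetry`.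
-/

noncomputable section

namespace Summit.NavierStokesRegularity.NavierStokesRegularity.Cruxes.ForcedSymmetry.Disproof

open MeasureTheory Set Filter Topology
open Literature.Analysis.FluidPDE Literature.Analysis.UnboundedOperators
open Summit.NavierStokesRegularity.NavierStokesRegularity.Theses.SymmetryModuliCount
open Summit.NavierStokesRegularity.NavierStokesRegularity.Theorems.MustSqueeze.Negative

set_option linter.dupNamespace false

/-! ## §1 Read-back over named clauses -/

/-- Membership in the Type-I KNSS-mild ancient class `A_C`: H1 (smooth on `t<0`) ∧ H2 (div-free) ∧
H3 (Oseen mild identity) ∧ H4 (Type-I rate `‖u‖ ≤ C/√(−t)`), the clauses of `MustSqueeze.Negative`. -/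
def InClassA (C : ℝ) (u : ℝ → EuclideanSpace ℝ (Fin 3) → EuclideanSpace ℝ (Fin 3)) : Prop :=
  H1 u ∧ H2 u ∧ H3 u ∧ H4 C u

/-- The infinitesimal generator `L_ξ u` of `ξ = (a, σ, A) ∈ sim(3)` acting on `u` (verbatim the crux). -/
def simGen (u : ℝ → EuclideanSpace ℝ (Fin 3) → EuclideanSpace ℝ (Fin 3)) (a : EuclideanSpace ℝ (Fin 3)) (σ : ℝ)
    (A : EuclideanSpace ℝ (Fin 3) →L[ℝ] EuclideanSpace ℝ (Fin 3)) (t : ℝ) (x : EuclideanSpace ℝ (Fin 3)) :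
    EuclideanSpace ℝ (Fin 3) :=
  fderiv ℝ (u t) x (a + σ • x + A x) + σ • u t x + (2 * σ * t) • timeDeriv u t x - A (u t x)

/-- The conclusion of the crux: some NONZERO `ξ = (a, σ, A)`, `A` skew, annihilates `u` on `t < 0`. -/
def HasSimSymmetry (u : ℝ → EuclideanSpace ℝ (Fin 3) → EuclideanSpace ℝ (Fin 3)) : Prop :=
  ∃ (a : EuclideanSpace ℝ (Fin 3)) (σ : ℝ) (A : EuclideanSpace ℝ (Fin 3) →L[ℝ] EuclideanSpace ℝ (Fin 3)),
    (∀ x, inner ℝ (A x) x = 0) ∧ ¬ (a = 0 ∧ σ = 0 ∧ A = 0) ∧ ∀ t < 0, ∀ x, simGen u a σ A t x = 0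

/-- **Read-back.** The crux is definitionally `∀ C u, u ∈ A_C → u has a nonzero similarity symmetry`. -/
theorem forcedSymmetry_iff :
    ForcedSymmetry ↔ ∀ (C : ℝ) (u : ℝ → EuclideanSpace ℝ (Fin 3) → EuclideanSpace ℝ (Fin 3)),
      InClassA C u → HasSimSymmetry u :=
  Iff.rfl

/-! ## §2 Degenerate instances hold -/

/-- A field vanishing identically on `t < 0` has EVERY similarity symmetry (here: translation by `e₀`). -/
theorem hasSimSymmetry_of_vanishes {u : ℝ → EuclideanSpace ℝ (Fin 3) → EuclideanSpace ℝ (Fin 3)}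
    (h : ∀ t < 0, ∀ x, u t x = 0) : HasSimSymmetry u := by
  refine ⟨e0, 0, 0, fun x => by simp, fun hh => ?_, fun t ht x => ?_⟩
  · have : ‖(e0 : EuclideanSpace ℝ (Fin 3))‖ = 1 := by simp [e0]
    rw [hh.1, norm_zero] at this
    exact zero_ne_one this
  · have hut : u t = fun _ => 0 := funext (h t ht)
    simp [simGen, hut]

/-- `C ≤ 0`: H4 alone forces `u ≡ 0` on `t<0`, so the crux holds there for trivial reasons
(intended under `∀ C`; not a defect). -/
theorem forcedSymmetry_holds_of_nonpos (C : ℝ) (hC : C ≤ 0)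
    (u : ℝ → EuclideanSpace ℝ (Fin 3) → EuclideanSpace ℝ (Fin 3)) (hu : InClassA C u) : HasSimSymmetry u :=
  hasSimSymmetry_of_vanishes (vanishes_of_h4_nonpos hC hu.2.2.2)

/-- The zero field lies in `A_C` for every `C ≥ 0` (hypotheses satisfiable) and is symmetric. -/
theorem inClassA_zero {C : ℝ} (hC : 0 ≤ C) :
    InClassA C (fun _ _ => 0) ∧ HasSimSymmetry (fun _ _ => (0 : EuclideanSpace ℝ (Fin 3))) :=
  ⟨⟨(inClass_zero hC).1.1, (inClass_zero hC).1.2.1, (inClass_zero hC).1.2.2.1, (inClass_zero hC).1.2.2.2.1⟩,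
    hasSimSymmetry_of_vanishes fun _ _ _ => rfl⟩

/-- Constants satisfy H1, H2, H3 (KNSS-mild: `isKNSSMild_const`) — they fail only H4 — and they ARE
symmetric (translation- and rotation-invariant).  Hence the crux with H4 deleted is not refuted by
constants.  (v7 amendment: it IS refuted on paper by the growing Beltrami solution `e^{−t}B_{ABC}`, see the
module docstring §2; the typed witness is deferred.  With H4 replaced by mere boundedness the statement
follows from the KNSS Liouville conjecture (L).) -/
theorem const_inClass_without_H4_and_symmetric (c : EuclideanSpace ℝ (Fin 3)) :
    (H1 (fun _ _ => c) ∧ H2 (fun _ _ => c) ∧ H3 (fun _ _ => c)) ∧ HasSimSymmetry (fun _ _ => c) := by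
  refine ⟨⟨(h1_h2_h6_const c).1, (h1_h2_h6_const c).2.1, isKNSSMild_const c⟩, ?_⟩
  refine ⟨e0, 0, 0, fun x => by simp, fun hh => ?_, fun t _ x => ?_⟩
  · have : ‖(e0 : EuclideanSpace ℝ (Fin 3))‖ = 1 := by simp [e0]
    rw [hh.1, norm_zero] at this
    exact zero_ne_one this
  · simp [simGen]

/-! ## §3 H3 (the Oseen/NS identity) is load-bearing: an explicit symmetry-free Type-I field -/

/-- `e₂`. -/
def e2 : EuclideanSpace ℝ (Fin 3) := EuclideanSpace.single 2 1

@[simp] theorem e0_c0 : e0 0 = 1 := by simp [e0]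
@[simp] theorem e0_c1 : e0 1 = 0 := by simp [e0]
@[simp] theorem e0_c2 : e0 2 = 0 := by simp [e0]
@[simp] theorem e1_c0 : e1 0 = 0 := by simp [e1]
@[simp] theorem e1_c1 : e1 1 = 1 := by simp [e1]
@[simp] theorem e1_c2 : e1 2 = 0 := by simp [e1]
@[simp] theorem e2_c0 : e2 0 = 0 := by simp [e2]
@[simp] theorem e2_c1 : e2 1 = 0 := by simp [e2]
@[simp] theorem e2_c2 : e2 2 = 1 := by simp [e2]

@[simp] theorem rot_c0 (x : EuclideanSpace ℝ (Fin 3)) : rot x 0 = - x 1 := (rot_coord x).1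
@[simp] theorem rot_c1 (x : EuclideanSpace ℝ (Fin 3)) : rot x 1 = x 0 := (rot_coord x).2.1
@[simp] theorem rot_c2 (x : EuclideanSpace ℝ (Fin 3)) : rot x 2 = 0 := (rot_coord x).2.2

/-- The rotation generator about the `e₀`-axis, `rot0 x = e₀ × x = x₁ e₂ − x₂ e₁`. -/
def rot0 : EuclideanSpace ℝ (Fin 3) →L[ℝ] EuclideanSpace ℝ (Fin 3) :=
  (EuclideanSpace.proj (1 : Fin 3) : EuclideanSpace ℝ (Fin 3) →L[ℝ] ℝ).smulRight e2 -
    (EuclideanSpace.proj (2 : Fin 3) : EuclideanSpace ℝ (Fin 3) →L[ℝ] ℝ).smulRight e1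

theorem rot0_apply (x : EuclideanSpace ℝ (Fin 3)) : rot0 x = x 1 • e2 - x 2 • e1 := rfl

@[simp] theorem rot0_c0 (x : EuclideanSpace ℝ (Fin 3)) : rot0 x 0 = 0 := by simp [rot0_apply]
@[simp] theorem rot0_c1 (x : EuclideanSpace ℝ (Fin 3)) : rot0 x 1 = - x 2 := by simp [rot0_apply]
@[simp] theorem rot0_c2 (x : EuclideanSpace ℝ (Fin 3)) : rot0 x 2 = x 1 := by simp [rot0_apply]

/-- The coordinate functional `x ↦ x₀`. -/
def proj0 : EuclideanSpace ℝ (Fin 3) →L[ℝ] ℝ := EuclideanSpace.proj (0 : Fin 3)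

@[simp] theorem proj0_apply (x : EuclideanSpace ℝ (Fin 3)) : proj0 x = x 0 := rfl

/-- The polynomial part of the witness profile: `P x = rot x + x₀ rot0 x = (−x₁, x₀ − x₀x₂, x₀x₁)`
(two vortices with DIFFERENT axes; the second one weighted by `x₀` to break every rotation). -/
def P (x : EuclideanSpace ℝ (Fin 3)) : EuclideanSpace ℝ (Fin 3) := rot x + x 0 • rot0 x

@[simp] theorem P_c0 (x : EuclideanSpace ℝ (Fin 3)) : P x 0 = - x 1 := by simp [P]
@[simp] theorem P_c1 (x : EuclideanSpace ℝ (Fin 3)) : P x 1 = x 0 - x 0 * x 2 := by simp [P]; ring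
@[simp] theorem P_c2 (x : EuclideanSpace ℝ (Fin 3)) : P x 2 = x 0 * x 1 := by simp [P]

/-- The Fréchet derivative of `P`: `DP x h = rot h + x₀ rot0 h + h₀ rot0 x`. -/
def DP (x : EuclideanSpace ℝ (Fin 3)) : EuclideanSpace ℝ (Fin 3) →L[ℝ] EuclideanSpace ℝ (Fin 3) :=
  rot + (x 0 • rot0 + proj0.smulRight (rot0 x))

theorem DP_apply (x h : EuclideanSpace ℝ (Fin 3)) : DP x h = rot h + (x 0 • rot0 h + h 0 • rot0 x) := by
  simp [DP]

@[simp] theorem DP_c0 (x h : EuclideanSpace ℝ (Fin 3)) : DP x h 0 = - h 1 := by simp [DP_apply]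
@[simp] theorem DP_c1 (x h : EuclideanSpace ℝ (Fin 3)) : DP x h 1 = h 0 - x 0 * h 2 - h 0 * x 2 := by
  simp [DP_apply]; ring
@[simp] theorem DP_c2 (x h : EuclideanSpace ℝ (Fin 3)) : DP x h 2 = x 0 * h 1 + h 0 * x 1 := by
  simp [DP_apply]

theorem hasFDerivAt_P (x : EuclideanSpace ℝ (Fin 3)) : HasFDerivAt P (DP x) x := by
  have h1 : HasFDerivAt (fun y : EuclideanSpace ℝ (Fin 3) => y 0) proj0 x := proj0.hasFDerivAt
  have h2 := h1.smul (rot0.hasFDerivAt (x := x))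
  exact rot.hasFDerivAt.add h2

theorem contDiff_P : ContDiff ℝ (⊤ : ℕ∞) P :=
  rot.contDiff.add (proj0.contDiff.smul rot0.contDiff)

/-- The witness profile `V x = e^{−‖x‖²} P x`. -/
def V (x : EuclideanSpace ℝ (Fin 3)) : EuclideanSpace ℝ (Fin 3) := gauss x • P x

/-- Its Fréchet derivative. -/
def DV (x : EuclideanSpace ℝ (Fin 3)) : EuclideanSpace ℝ (Fin 3) →L[ℝ] EuclideanSpace ℝ (Fin 3) :=
  gauss x • DP x + ((gauss x * (-2 : ℝ)) • innerSL ℝ x).smulRight (P x)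

theorem hasFDerivAt_V (x : EuclideanSpace ℝ (Fin 3)) : HasFDerivAt V (DV x) x :=
  (hasFDerivAt_gauss x).smul (hasFDerivAt_P x)

theorem DV_apply (x h : EuclideanSpace ℝ (Fin 3)) :
    DV x h = gauss x • DP x h + (gauss x * (-2) * inner ℝ x h) • P x := by
  simp only [DV, add_apply, FunLike.coe_smul, Pi.smul_apply,
    ContinuousLinearMap.smulRight_apply, innerSL_apply_apply, smul_eq_mul]

theorem contDiff_V : ContDiff ℝ (⊤ : ℕ∞) V :=
  (Real.contDiff_exp.comp (contDiff_norm_sq ℝ).neg).smul contDiff_P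

/-- **The drop-H3 witness** `w t x = e^{t/2} e^{−‖x‖²} (rot x + x₀ rot0 x)`. -/
def w (t : ℝ) (x : EuclideanSpace ℝ (Fin 3)) : EuclideanSpace ℝ (Fin 3) := Real.exp (t / 2) • V x

theorem hasFDerivAt_w (t : ℝ) (x : EuclideanSpace ℝ (Fin 3)) :
    HasFDerivAt (w t) (Real.exp (t / 2) • DV x) x :=
  (hasFDerivAt_V x).const_smul (Real.exp (t / 2))

theorem fderiv_w (t : ℝ) (x : EuclideanSpace ℝ (Fin 3)) : fderiv ℝ (w t) x = Real.exp (t / 2) • DV x :=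
  (hasFDerivAt_w t x).fderiv

theorem hasDerivAt_expHalf (t : ℝ) : HasDerivAt (fun s : ℝ => Real.exp (s / 2)) (Real.exp (t / 2) / 2) t := by
  have h : HasDerivAt (fun s : ℝ => s / 2) (1 / 2 : ℝ) t := by
    simpa using (hasDerivAt_id t).div_const 2
  convert h.exp using 1
  ring

theorem hasDerivAt_w_time (t : ℝ) (x : EuclideanSpace ℝ (Fin 3)) :
    HasDerivAt (fun s => w s x) ((Real.exp (t / 2) / 2) • V x) t :=
  (hasDerivAt_expHalf t).smul_const (V x)

theorem timeDeriv_w (t : ℝ) (x : EuclideanSpace ℝ (Fin 3)) : timeDeriv w t x = (Real.exp (t / 2) / 2) • V x :=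
  (hasDerivAt_w_time t x).deriv

/-! ### The witness satisfies H1, H2, H4 -/

/-- H1: `w` is smooth (globally). -/
theorem w_h1 : H1 w := by
  have hs : ContDiff ℝ (⊤ : ℕ∞) (fun p : ℝ × EuclideanSpace ℝ (Fin 3) => Real.exp (p.1 / 2)) :=
    Real.contDiff_exp.comp (contDiff_fst.div_const 2)
  have hV : ContDiff ℝ (⊤ : ℕ∞) (fun p : ℝ × EuclideanSpace ℝ (Fin 3) => V p.2) := contDiff_V.comp contDiff_snd
  exact (hs.smul hV).contDiffOn

/-- `⟪e_i, v⟫ = v i`. -/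
theorem inner_single_one_left (i : Fin 3) (v : EuclideanSpace ℝ (Fin 3)) :
    inner ℝ (EuclideanSpace.single i (1 : ℝ)) v = v i := by
  rw [EuclideanSpace.inner_single_left]; simp

/-- `⟪v, e_i⟫ = v i`. -/
theorem inner_single_one_right (i : Fin 3) (v : EuclideanSpace ℝ (Fin 3)) :
    inner ℝ v (EuclideanSpace.single i (1 : ℝ)) = v i := by
  rw [EuclideanSpace.inner_single_right]; simp

/-- H2: `w` is divergence free:
`div = e^{t/2} g (tr DP − 2⟪x, P x⟫) = e^{t/2} g (0 − 0)`. -/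
theorem w_h2 : H2 w := by
  intro t _ x
  have hb := divergence_eq_sum_inner_fderiv (EuclideanSpace.basisFun (Fin 3) ℝ) (w t) x
  rw [hb, fderiv_w, Fin.sum_univ_three]
  simp only [EuclideanSpace.basisFun_apply, FunLike.coe_smul, Pi.smul_apply, real_inner_smul_right,
    inner_single_one_left, inner_single_one_right, DV_apply, PiLp.add_apply, PiLp.smul_apply, smul_eq_mul, DP_c0, DP_c1, DP_c2,
    P_c0, P_c1, P_c2, PiLp.single_apply]
  simp
  ring

/-- `|x i| ≤ ‖x‖` on `ℝ³`. -/
theorem abs_coord_le_norm (x : EuclideanSpace ℝ (Fin 3)) (i : Fin 3) : |x i| ≤ ‖x‖ := by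
  simpa [Real.norm_eq_abs] using PiLp.norm_apply_le x i

/-- `‖rot0 x‖ ≤ ‖x‖`. -/
theorem norm_rot0_le (x : EuclideanSpace ℝ (Fin 3)) : ‖rot0 x‖ ≤ ‖x‖ := by
  have h1 : ‖rot0 x‖ ^ 2 = x 2 ^ 2 + x 1 ^ 2 := by
    rw [EuclideanSpace.real_norm_sq_eq, Fin.sum_univ_three, rot0_c0, rot0_c1, rot0_c2]; ring
  have h2 : ‖x‖ ^ 2 = x 0 ^ 2 + x 1 ^ 2 + x 2 ^ 2 := by
    rw [EuclideanSpace.real_norm_sq_eq, Fin.sum_univ_three]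
  have h3 : ‖rot0 x‖ ^ 2 ≤ ‖x‖ ^ 2 := by rw [h1, h2]; nlinarith [sq_nonneg (x 0)]
  exact (pow_le_pow_iff_left₀ (norm_nonneg _) (norm_nonneg _) two_ne_zero).1 h3

/-- `‖P x‖ ≤ ‖x‖ + ‖x‖²`. -/
theorem norm_P_le (x : EuclideanSpace ℝ (Fin 3)) : ‖P x‖ ≤ ‖x‖ + ‖x‖ ^ 2 := by
  rw [P]
  calc ‖rot x + x 0 • rot0 x‖ ≤ ‖rot x‖ + ‖x 0 • rot0 x‖ := norm_add_le _ _
    _ = ‖rot x‖ + |x 0| * ‖rot0 x‖ := by rw [norm_smul, Real.norm_eq_abs]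
    _ ≤ ‖x‖ + ‖x‖ * ‖x‖ := by
        gcongr
        · exact norm_rot_le x
        · exact abs_coord_le_norm x 0
        · exact norm_rot0_le x
    _ = ‖x‖ + ‖x‖ ^ 2 := by ring

/-- `‖V x‖ ≤ 2`. -/
theorem norm_V_le (x : EuclideanSpace ℝ (Fin 3)) : ‖V x‖ ≤ 2 := by
  rw [V, norm_smul, Real.norm_eq_abs, abs_of_pos (gauss_pos x)]
  have h1 := norm_mul_gauss_le_one x
  have h2 := two_mul_norm_sq_mul_gauss_le_one x
  have hg := gauss_pos x
  calc gauss x * ‖P x‖ ≤ gauss x * (‖x‖ + ‖x‖ ^ 2) := by gcongr; exact norm_P_le x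
    _ = ‖x‖ * gauss x + ‖x‖ ^ 2 * gauss x := by ring
    _ ≤ 1 + 1 := add_le_add h1 (by linarith)
    _ = 2 := by norm_num

/-- H4: the Type-I rate with constant `2`: `‖w‖ ≤ 2 e^{t/2} ≤ 2/√(−t)`. -/
theorem w_h4 : H4 2 w := by
  intro t ht x
  have hs : 0 < Real.sqrt (-t) := Real.sqrt_pos.2 (by linarith)
  rw [le_div_iff₀ hs, w, norm_smul, Real.norm_eq_abs, abs_of_pos (Real.exp_pos _)]
  have h2 : Real.sqrt (-t) * Real.exp (t / 2) ≤ 1 := by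
    have := sqrt_mul_exp_neg_half_le_one (by linarith : 0 ≤ -t)
    simpa [neg_neg] using this
  calc Real.exp (t / 2) * ‖V x‖ * Real.sqrt (-t) = (Real.sqrt (-t) * Real.exp (t / 2)) * ‖V x‖ := by ring
    _ ≤ 1 * 2 := mul_le_mul h2 (norm_V_le x) (norm_nonneg _) zero_le_one
    _ = 2 := by norm_num



/-! ### The witness also carries the scale-invariant GRADIENT bound of the drift class -/

/-- `s² e^{−s} ≤ 2` for `s ≥ 0`. -/
theorem sq_mul_exp_neg_le_two {s : ℝ} (hs : 0 ≤ s) : s ^ 2 * Real.exp (-s) ≤ 2 := by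
  have h := Real.quadratic_le_exp_of_nonneg hs
  rw [Real.exp_neg, mul_inv_le_iff₀ (Real.exp_pos _)]
  nlinarith

/-- `g ‖x‖³ ≤ 5/4` (AM–GM `‖x‖³ ≤ (‖x‖² + ‖x‖⁴)/2`, `g‖x‖² ≤ 1/2`, `g‖x‖⁴ ≤ 2`). -/
theorem gauss_mul_norm_cube_le (x : EuclideanSpace ℝ (Fin 3)) : gauss x * ‖x‖ ^ 3 ≤ 5 / 4 := by
  have h1 := two_mul_norm_sq_mul_gauss_le_one x
  have h2 : (‖x‖ ^ 2) ^ 2 * gauss x ≤ 2 := by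
    have := sq_mul_exp_neg_le_two (sq_nonneg ‖x‖)
    simpa [gauss] using this
  have hg := gauss_pos x
  have hn := norm_nonneg x
  nlinarith [sq_nonneg (‖x‖ - ‖x‖ ^ 2), mul_nonneg hg.le (sq_nonneg (‖x‖ - ‖x‖ ^ 2))]

/-- Operator-norm bound `‖DP x‖ ≤ 1 + 2‖x‖`. -/
theorem norm_DP_le (x : EuclideanSpace ℝ (Fin 3)) : ‖DP x‖ ≤ 1 + 2 * ‖x‖ := by
  refine ContinuousLinearMap.opNorm_le_bound _ (by positivity) fun h => ?_
  rw [DP_apply]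
  calc ‖rot h + (x 0 • rot0 h + h 0 • rot0 x)‖ ≤ ‖rot h‖ + (‖x 0 • rot0 h‖ + ‖h 0 • rot0 x‖) :=
        (norm_add_le _ _).trans (add_le_add le_rfl (norm_add_le _ _))
    _ = ‖rot h‖ + (|x 0| * ‖rot0 h‖ + |h 0| * ‖rot0 x‖) := by rw [norm_smul, norm_smul, Real.norm_eq_abs, Real.norm_eq_abs]
    _ ≤ ‖h‖ + (‖x‖ * ‖h‖ + ‖h‖ * ‖x‖) := by
        gcongr
        · exact norm_rot_le h
        · exact abs_coord_le_norm x 0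
        · exact norm_rot0_le h
        · exact abs_coord_le_norm h 0
        · exact norm_rot0_le x
    _ = (1 + 2 * ‖x‖) * ‖h‖ := by ring

/-- Operator-norm bound `‖DV x‖ ≤ 7`. -/
theorem norm_DV_le (x : EuclideanSpace ℝ (Fin 3)) : ‖DV x‖ ≤ 7 := by
  have hg := gauss_pos x
  have hn := norm_nonneg x
  have h1 := norm_mul_gauss_le_one x
  have h2 := two_mul_norm_sq_mul_gauss_le_one x
  have h3 := gauss_mul_norm_cube_le x
  have hgl := gauss_le_one x
  refine ContinuousLinearMap.opNorm_le_bound _ (by norm_num) fun h => ?_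
  rw [DV_apply]
  calc ‖gauss x • DP x h + (gauss x * -2 * inner ℝ x h) • P x‖
      ≤ ‖gauss x • DP x h‖ + ‖(gauss x * -2 * inner ℝ x h) • P x‖ := norm_add_le _ _
    _ = gauss x * ‖DP x h‖ + 2 * gauss x * |inner ℝ x h| * ‖P x‖ := by
        rw [norm_smul, norm_smul, Real.norm_eq_abs, Real.norm_eq_abs, abs_of_pos hg, abs_mul, abs_mul,
          abs_of_pos hg, abs_neg, abs_two]
        ring
    _ ≤ gauss x * ((1 + 2 * ‖x‖) * ‖h‖) + 2 * gauss x * (‖x‖ * ‖h‖) * (‖x‖ + ‖x‖ ^ 2) := by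
        gcongr
        · exact (DP x).le_of_opNorm_le (norm_DP_le x) h
        · exact abs_real_inner_le_norm x h
        · exact norm_P_le x
    _ = (gauss x + 2 * (‖x‖ * gauss x) + (2 * (‖x‖ ^ 2 * gauss x)) + 2 * (gauss x * ‖x‖ ^ 3)) * ‖h‖ := by ring
    _ ≤ (1 + 2 * 1 + 1 + 2 * (5 / 4)) * ‖h‖ := by gcongr
    _ ≤ 7 * ‖h‖ := by nlinarith [norm_nonneg h]

/-- The witness obeys the scale-invariant gradient bound `‖∇w(t,x)‖ ≤ 7/(−t)` of the Type-I DRIFT class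
(the hypothesis class of the sister crux `FiniteTangentModuliMild`, stmt-14049 — route rev 3; formerly `FiniteTangentModuli` stmt-4055, refuted p73226): `‖∇w‖ ≤ 7e^{t/2} ≤ 7/(−t)`. -/
theorem w_grad (t : ℝ) (ht : t < 0) (x : EuclideanSpace ℝ (Fin 3)) : ‖fderiv ℝ (w t) x‖ ≤ 7 / (-t) := by
  have ht' : 0 < -t := by linarith
  rw [fderiv_w, norm_smul, Real.norm_eq_abs, abs_of_pos (Real.exp_pos _), le_div_iff₀ ht']
  have h1 : (-t) * Real.exp (t / 2) ≤ 1 := by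
    have := mul_exp_neg_half_le_one ht'.le
    simpa [neg_neg, neg_div] using this
  calc Real.exp (t / 2) * ‖DV x‖ * -t = ((-t) * Real.exp (t / 2)) * ‖DV x‖ := by ring
    _ ≤ 1 * 7 := mul_le_mul h1 (norm_DV_le x) (norm_nonneg _) zero_le_one
    _ = 7 := by norm_num

/-! ### The witness has NO nonzero infinitesimal similarity symmetry -/

/-- The `t`-independent part of `e^{-t/2} L_ξ w`. -/
def core (a : EuclideanSpace ℝ (Fin 3)) (σ : ℝ) (A : EuclideanSpace ℝ (Fin 3) →L[ℝ] EuclideanSpace ℝ (Fin 3))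
    (x : EuclideanSpace ℝ (Fin 3)) : EuclideanSpace ℝ (Fin 3) :=
  DV x (a + σ • x + A x) + σ • V x - A (V x)

/-- `L_ξ w (t,x) = e^{t/2} (core(x) + σ t V x)`: the non-self-similar clock `e^{t/2}` leaves a term
LINEAR in `t`, which is what kills the scaling component `σ`. -/
theorem simGen_w (a : EuclideanSpace ℝ (Fin 3)) (σ : ℝ) (A : EuclideanSpace ℝ (Fin 3) →L[ℝ] EuclideanSpace ℝ (Fin 3))
    (t : ℝ) (x : EuclideanSpace ℝ (Fin 3)) :
    simGen w a σ A t x = Real.exp (t / 2) • (core a σ A x + (σ * t) • V x) := by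
  unfold simGen
  rw [fderiv_w, timeDeriv_w]
  simp only [w, map_smul, core, FunLike.coe_smul, Pi.smul_apply]
  module

/-- The reduced (Gaussian-free, polynomial) symmetry defect at `σ = 0`:
`DV x (a + A x) − A (V x) = g(x) · R(x)`. -/
def R (a : EuclideanSpace ℝ (Fin 3)) (A : EuclideanSpace ℝ (Fin 3) →L[ℝ] EuclideanSpace ℝ (Fin 3))
    (x : EuclideanSpace ℝ (Fin 3)) : EuclideanSpace ℝ (Fin 3) :=
  DP x (a + A x) + (-2 * inner ℝ x (a + A x)) • P x - A (P x)

/-- At `σ = 0` the defect factors through the Gaussian: `core a 0 A x = g(x) • R a A x`. -/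
theorem core_zero_sigma (a : EuclideanSpace ℝ (Fin 3)) (A : EuclideanSpace ℝ (Fin 3) →L[ℝ] EuclideanSpace ℝ (Fin 3))
    (x : EuclideanSpace ℝ (Fin 3)) : core a 0 A x = gauss x • R a A x := by
  simp only [core, R, zero_smul, add_zero, DV_apply, V, map_smul]
  module

section Rigid

variable {a : EuclideanSpace ℝ (Fin 3)} {σ : ℝ} {A : EuclideanSpace ℝ (Fin 3) →L[ℝ] EuclideanSpace ℝ (Fin 3)}

/-- `P e₀ = e₁`. -/
theorem P_e0 : P e0 = e1 := by ext i; fin_cases i <;> simp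
/-- `P 0 = 0`. -/
theorem P_zero : P 0 = 0 := by ext i; fin_cases i <;> simp
/-- `P e₂ = 0`. -/
theorem P_e2 : P e2 = 0 := by ext i; fin_cases i <;> simp
/-- `P (−e₂) = 0`. -/
theorem P_neg_e2 : P (-e2) = 0 := by ext i; fin_cases i <;> simp
/-- `V e₀ = e^{-1} e₁ ≠ 0`. -/
theorem V_e0 : V e0 = gauss e0 • e1 := by rw [V, P_e0]

@[simp] theorem inner_e0_left (v : EuclideanSpace ℝ (Fin 3)) : inner ℝ e0 v = v 0 := inner_single_one_left 0 v
@[simp] theorem inner_e2_left (v : EuclideanSpace ℝ (Fin 3)) : inner ℝ e2 v = v 2 := inner_single_one_left 2 v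

/-- Step 1: the scaling component vanishes (slices `t = -1, -2` at `x = e₀`, where `V e₀ = e^{-1} e₁ ≠ 0`). -/
theorem sigma_eq_zero (h : ∀ t < 0, ∀ x, simGen w a σ A t x = 0) : σ = 0 := by
  have h1 := h (-1) (by norm_num) e0
  have h2 := h (-2) (by norm_num) e0
  rw [simGen_w] at h1 h2
  have h1' := (smul_eq_zero.1 h1).resolve_left (Real.exp_pos _).ne'
  have h2' := (smul_eq_zero.1 h2).resolve_left (Real.exp_pos _).ne'
  have key : σ • V e0 = (core a σ A e0 + (σ * (-1 : ℝ)) • V e0) - (core a σ A e0 + (σ * (-2 : ℝ)) • V e0) := by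
    module
  rw [h1', h2', sub_zero, V_e0, smul_smul] at key
  have h3 := (smul_eq_zero.1 key).resolve_right e1_ne_zero
  exact (mul_eq_zero.1 h3).resolve_right (gauss_pos e0).ne'

/-- Step 2: with `σ = 0`, the reduced defect vanishes everywhere. -/
theorem R_eq_zero (h : ∀ t < 0, ∀ x, simGen w a σ A t x = 0) (x : EuclideanSpace ℝ (Fin 3)) : R a A x = 0 := by
  have hσ := sigma_eq_zero h
  have h1 := h (-1) (by norm_num) x
  rw [simGen_w, hσ, zero_mul, zero_smul, add_zero, core_zero_sigma] at h1
  have h1' := (smul_eq_zero.1 h1).resolve_left (Real.exp_pos _).ne'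
  exact (smul_eq_zero.1 h1').resolve_left (gauss_pos x).ne'

/-- Polarisation of skewness. -/
theorem skew_polar (hA : ∀ x, inner ℝ (A x) x = 0) (x y : EuclideanSpace ℝ (Fin 3)) :
    inner ℝ (A x) y = - inner ℝ (A y) x := by
  have h := hA (x + y)
  rw [map_add, inner_add_left, inner_add_right, inner_add_right, hA x, hA y] at h
  linarith

/-- Skewness: diagonal entries vanish, `(A e_i)_i = 0`. -/
theorem skew_diag (hA : ∀ x, inner ℝ (A x) x = 0) (i : Fin 3) : A (EuclideanSpace.single i 1) i = 0 := by
  have := hA (EuclideanSpace.single i 1); rwa [inner_single_one_right] at this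

/-- Skewness: `(A e_j)_i = −(A e_i)_j`. -/
theorem skew_off (hA : ∀ x, inner ℝ (A x) x = 0) (i j : Fin 3) :
    A (EuclideanSpace.single j 1) i = - A (EuclideanSpace.single i 1) j := by
  have := skew_polar hA (EuclideanSpace.single j 1) (EuclideanSpace.single i 1)
  rwa [inner_single_one_right, inner_single_one_right] at this

/-- Step 3: all twelve coordinates of `(a, A e₀, A e₁, A e₂)` vanish. -/
theorem coords_eq_zero (hA : ∀ x, inner ℝ (A x) x = 0) (h : ∀ t < 0, ∀ x, simGen w a σ A t x = 0) :
    (a 0 = 0 ∧ a 1 = 0 ∧ a 2 = 0) ∧ (A e0 0 = 0 ∧ A e0 1 = 0 ∧ A e0 2 = 0) ∧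
      (A e1 0 = 0 ∧ A e1 1 = 0 ∧ A e1 2 = 0) ∧ (A e2 0 = 0 ∧ A e2 1 = 0 ∧ A e2 2 = 0) := by
  -- skewness
  have d0 : A e0 0 = 0 := skew_diag hA 0
  have d1 : A e1 1 = 0 := skew_diag hA 1
  have d2 : A e2 2 = 0 := skew_diag hA 2
  have o01 : A e1 0 = - A e0 1 := skew_off hA 0 1
  have o02 : A e2 0 = - A e0 2 := skew_off hA 0 2
  have o12 : A e2 1 = - A e1 2 := skew_off hA 1 2
  -- the reduced defect at 0, e₂, -e₂, e₀
  have r0 := R_eq_zero h 0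
  have r2 := R_eq_zero h e2
  have r2' := R_eq_zero h (-e2)
  have r1 := R_eq_zero h e0
  simp only [R, map_zero, add_zero, P_zero, smul_zero, sub_zero, P_e2, P_neg_e2, map_neg, P_e0] at r0 r2 r2' r1
  have c00 := congrArg (fun v : EuclideanSpace ℝ (Fin 3) => v 0) r0
  have c01 := congrArg (fun v : EuclideanSpace ℝ (Fin 3) => v 1) r0
  have c20 := congrArg (fun v : EuclideanSpace ℝ (Fin 3) => v 0) r2
  have c2'1 := congrArg (fun v : EuclideanSpace ℝ (Fin 3) => v 1) r2'
  have c11 := congrArg (fun v : EuclideanSpace ℝ (Fin 3) => v 1) r1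
  have c12 := congrArg (fun v : EuclideanSpace ℝ (Fin 3) => v 2) r1
  simp only [DP_c0, DP_c1, DP_c2, PiLp.add_apply, PiLp.sub_apply, PiLp.neg_apply, PiLp.smul_apply,
    PiLp.zero_apply, smul_eq_mul, e0_c0, e0_c1, e0_c2, e1_c1, e1_c2, e2_c0, e2_c2,
    inner_e0_left] at c00 c01 c20 c2'1 c11 c12
  have ha1 : a 1 = 0 := by linarith
  have ha0 : a 0 = 0 := by nlinarith
  have h21 : A e2 1 = 0 := by linarith
  have h20 : A e2 0 = 0 := by nlinarith
  have h02 : A e0 2 = 0 := by linarith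
  have ha2 : a 2 = 0 := by nlinarith
  have h12 : A e1 2 = 0 := by linarith
  have h01 : A e0 1 = 0 := by nlinarith
  refine ⟨⟨ha0, ha1, ha2⟩, ⟨d0, h01, h02⟩, ⟨by linarith, d1, h12⟩, ⟨h20, h21, d2⟩⟩

/-- **Rigidity of the witness**: `L_ξ w ≡ 0` on `t < 0` with `A` skew forces `ξ = (a, σ, A) = 0`. -/
theorem w_rigid (hA : ∀ x, inner ℝ (A x) x = 0) (h : ∀ t < 0, ∀ x, simGen w a σ A t x = 0) :
    a = 0 ∧ σ = 0 ∧ A = 0 := by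
  obtain ⟨⟨ha0, ha1, ha2⟩, ⟨h00, h01, h02⟩, ⟨h10, h11, h12⟩, ⟨h20, h21, h22⟩⟩ := coords_eq_zero hA h
  refine ⟨?_, sigma_eq_zero h, ?_⟩
  · ext i; fin_cases i <;> simp [ha0, ha1, ha2]
  · have hA0 : A e0 = 0 := by ext i; fin_cases i <;> simp [h00, h01, h02]
    have hA1 : A e1 = 0 := by ext i; fin_cases i <;> simp [h10, h11, h12]
    have hA2 : A e2 = 0 := by ext i; fin_cases i <;> simp [h20, h21, h22]
    refine ContinuousLinearMap.coe_inj.1 ((EuclideanSpace.basisFun (Fin 3) ℝ).toBasis.ext fun i => ?_)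
    fin_cases i
    · simpa [e0] using hA0
    · simpa [e1] using hA1
    · simpa [e2] using hA2

end Rigid

/-! ### Conclusion: H3 is load-bearing -/

/-- The crux with ONLY the KNSS/Oseen mild clause H3 deleted (the "kinematic" Type-I class). -/
def ForcedSymmetryWithoutH3 : Prop :=
  ∀ (C : ℝ) (u : ℝ → EuclideanSpace ℝ (Fin 3) → EuclideanSpace ℝ (Fin 3)), H1 u ∧ H2 u ∧ H4 C u → HasSimSymmetry u

/-- **Any proof of `ForcedSymmetry` must use the Oseen identity H3.**  With H3 deleted the statement
is FALSE: `w t x = e^{t/2} e^{−‖x‖²}(rot x + x₀ rot0 x)` is smooth, divergence free, obeys the Type-I rate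
with `C = 2`, and has NO nonzero infinitesimal similarity symmetry (`w_rigid`).  In particular a
dimension/symmetry count cannot come from the typed side clauses: smoothness + incompressibility + the
Type-I ceiling carry symmetry-free fields (indeed an infinite-dimensional family of them). -/
theorem forcedSymmetry_false_without_H3 : ¬ ForcedSymmetryWithoutH3 := by
  intro h
  obtain ⟨a, σ, A, hA, hne, hL⟩ := h 2 w ⟨w_h1, w_h2, w_h4⟩
  exact hne (w_rigid hA hL)


/-- The crux transplanted to the GENERAL Type-I drift class (smooth, divergence free, `‖u‖ ≤ C/√(−t)`,
`‖∇u‖ ≤ C/(−t)`; NOT necessarily Navier–Stokes) — the hypothesis class of `FiniteTangentModuli`. -/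
def ForcedSymmetryOnDriftClass : Prop :=
  ∀ (C : ℝ) (u : ℝ → EuclideanSpace ℝ (Fin 3) → EuclideanSpace ℝ (Fin 3)), H1 u → H2 u → H4 C u →
    (∀ t < 0, ∀ x, ‖fderiv ℝ (u t) x‖ ≤ C / (-t)) → HasSimSymmetry u

/-- **Symmetry is not forced on Type-I drifts.**  Even with the scale-invariant gradient bound added,
the kinematic class carries the symmetry-free witness `w` (constant `C = 7`).  So no argument that sees
`u` only as a Type-I drift (the setting of `FiniteTangentModuli` / the linearised engine for general
drifts) can yield `ForcedSymmetry`; the nonlinear Oseen identity for `u` itself is indispensable. -/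
theorem not_forcedSymmetryOnDriftClass : ¬ ForcedSymmetryOnDriftClass := by
  intro h
  have h4 : H4 7 w := fun t ht x => (w_h4 t ht x).trans
    (div_le_div_of_nonneg_right (by norm_num) (Real.sqrt_nonneg _))
  obtain ⟨a, σ, A, hA, hne, hL⟩ := h 7 w w_h1 w_h2 h4 w_grad
  exact hne (w_rigid hA hL)

/-! ## §4 Why it resists: the crux is implied by the Type-I Liouville statement `X` -/

/-- `X ⇒ ForcedSymmetry`: if `A_C = {0}` every member is (vacuously) symmetric.  So a refutation of the
crux is AT LEAST a nontrivial Type-I KNSS-mild ancient solution (`¬X`), the open Type-I Liouville problem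
(KNSS2009 §6 Prop 6.1; BradshawTsai2017CPDE Open Problem 5.1; ChaeWolf2017 Thm 1.3 only for λ≈1). -/
theorem forcedSymmetry_of_typeIAncientLiouville (hX : TypeIAncientLiouville) :
    ∀ (C : ℝ) (u : ℝ → EuclideanSpace ℝ (Fin 3) → EuclideanSpace ℝ (Fin 3)), InClassA C u → HasSimSymmetry u :=
  fun C u hu => hasSimSymmetry_of_vanishes (hX C u hu)


/-- The conclusion of `SymmetricLiouville` over the named clauses (read-back, `Iff.rfl`). -/
theorem symmetricLiouville_iff :
    SymmetricLiouville ↔ ∀ (C : ℝ) (u : ℝ → EuclideanSpace ℝ (Fin 3) → EuclideanSpace ℝ (Fin 3)),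
      InClassA C u → ∀ (a : EuclideanSpace ℝ (Fin 3)) (σ : ℝ) (A : EuclideanSpace ℝ (Fin 3) →L[ℝ] EuclideanSpace ℝ (Fin 3)),
        (∀ x, inner ℝ (A x) x = 0) → ¬ (a = 0 ∧ σ = 0 ∧ A = 0) → (∀ t < 0, ∀ x, simGen u a σ A t x = 0) →
          ∀ t < 0, ∀ x, u t x = 0 :=
  Iff.rfl

/-- **The dichotomy is exact**: `X ⇔ ForcedSymmetry ∧ SymmetricLiouville` (both directions pure logic;
`⇐` is the route's deciding theorem, `⇒` because `A_C = {0}` makes both conjuncts vacuous).  So the crux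
is PRECISELY the residual of the Type-I Liouville problem modulo its symmetric cases — neither weaker
nor stronger information is hidden in the typing. -/
theorem typeIAncientLiouville_iff_forced_and_symmetric :
    TypeIAncientLiouville ↔
      (∀ (C : ℝ) (u : ℝ → EuclideanSpace ℝ (Fin 3) → EuclideanSpace ℝ (Fin 3)), InClassA C u → HasSimSymmetry u) ∧
      (∀ (C : ℝ) (u : ℝ → EuclideanSpace ℝ (Fin 3) → EuclideanSpace ℝ (Fin 3)),
        InClassA C u → ∀ (a : EuclideanSpace ℝ (Fin 3)) (σ : ℝ) (A : EuclideanSpace ℝ (Fin 3) →L[ℝ] EuclideanSpace ℝ (Fin 3)),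
          (∀ x, inner ℝ (A x) x = 0) → ¬ (a = 0 ∧ σ = 0 ∧ A = 0) → (∀ t < 0, ∀ x, simGen u a σ A t x = 0) →
            ∀ t < 0, ∀ x, u t x = 0) := by
  constructor
  · intro hX
    exact ⟨fun C u hu => hasSimSymmetry_of_vanishes (hX C u hu), fun C u hu _ _ _ _ _ _ => hX C u hu⟩
  · rintro ⟨hF, hS⟩ C u hu
    obtain ⟨a, σ, A, hA, hne, hL⟩ := hF C u hu
    exact hS C u hu a σ A hA hne hL

/-! ## §5 Boundary: the perturbative regime `C ≤ ε` is empty (tree theorem, reused) -/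

/-- The typed class `A_C` of the route IS the tree's `IsTypeIAncientMild C` (KNSS-mild Type-I ancient
fields, `Literature/Analysis/FluidPDE/TypeIAncientMild.lean`), definitionally up to `1 * (t - τ)`. -/
theorem inClassA_iff_isTypeIAncientMild {C : ℝ} {u : ℝ → EuclideanSpace ℝ (Fin 3) → EuclideanSpace ℝ (Fin 3)} :
    InClassA C u ↔ IsTypeIAncientMild C u := by
  rw [isTypeIAncientMild_iff]
  rfl

/-- **Boundary lemma: the perturbative regime is empty.**  There is an absolute `ε > 0` such that for
`C ≤ ε` the class `A_C` is `{0}` (the tree's `Theorems.exists_typeIAncientMild_eq_zero_of_small`: the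
Type-I bound halves itself through the Oseen identity while `32 C_B C ≤ 1`; Leray 1934 (3.9), KNSS2009
§4 p. 8), so `ForcedSymmetry` — indeed `X` and every crux of the route — holds there for trivial
reasons.  Any counterexample to the crux has Type-I constant `C > ε`: the content of the crux sits
entirely at LARGE `C`, where no perturbative/contraction argument is available. -/
theorem exists_eps_inClassA_vanishes :
    ∃ ε : ℝ, 0 < ε ∧ ∀ (C : ℝ) (u : ℝ → EuclideanSpace ℝ (Fin 3) → EuclideanSpace ℝ (Fin 3)),
      C ≤ ε → InClassA C u → (∀ t < 0, ∀ x, u t x = 0) := by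
  obtain ⟨ε, hε, h⟩ :=
    Summit.NavierStokesRegularity.NavierStokesRegularity.Theorems.exists_typeIAncientMild_eq_zero_of_small
  exact ⟨ε, hε, fun C u hC hu => h C u (inClassA_iff_isTypeIAncientMild.1 hu) hC⟩

/-- Hence the crux holds for `C ≤ ε` (every member is `0`, which is symmetric). -/
theorem exists_eps_forcedSymmetry_small :
    ∃ ε : ℝ, 0 < ε ∧ ∀ (C : ℝ) (u : ℝ → EuclideanSpace ℝ (Fin 3) → EuclideanSpace ℝ (Fin 3)),
      C ≤ ε → InClassA C u → HasSimSymmetry u := by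
  obtain ⟨ε, hε, h⟩ := exists_eps_inClassA_vanishes
  exact ⟨ε, hε, fun C u hC hu => hasSimSymmetry_of_vanishes (h C u hC hu)⟩

/-! ## §6 Modelling remark (planner): the 8th generator — time shift -/

/-- The generator of the FULL point-symmetry algebra of the ancient Type-I class: `sim(3)` plus the time
shift `θ ∂_t` (backward shifts `t ↦ t − θ`, `θ ≥ 0`, map `A_C` into itself with the same `C`).
`simGen8 u a σ A θ = L_ξ u + θ ∂_t u`; for `σ ≠ 0` it is the spiral scaling centred at the time
`t₀ = −θ/(2σ)` instead of `0`. -/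
def simGen8 (u : ℝ → EuclideanSpace ℝ (Fin 3) → EuclideanSpace ℝ (Fin 3)) (a : EuclideanSpace ℝ (Fin 3)) (σ : ℝ)
    (A : EuclideanSpace ℝ (Fin 3) →L[ℝ] EuclideanSpace ℝ (Fin 3)) (θ : ℝ) (t : ℝ) (x : EuclideanSpace ℝ (Fin 3)) :
    EuclideanSpace ℝ (Fin 3) :=
  simGen u a σ A t x + θ • timeDeriv u t x

/-- Symmetry under a one-parameter subgroup of the 8-dimensional group (the card's informal "u is
invariant under a one-parameter group of translations∘rotations∘scalings", blow-up time NOT pinned). -/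
def HasSimSymmetry8 (u : ℝ → EuclideanSpace ℝ (Fin 3) → EuclideanSpace ℝ (Fin 3)) : Prop :=
  ∃ (a : EuclideanSpace ℝ (Fin 3)) (σ : ℝ) (A : EuclideanSpace ℝ (Fin 3) →L[ℝ] EuclideanSpace ℝ (Fin 3)) (θ : ℝ),
    (∀ x, inner ℝ (A x) x = 0) ∧ ¬ (a = 0 ∧ σ = 0 ∧ A = 0 ∧ θ = 0) ∧ ∀ t < 0, ∀ x, simGen8 u a σ A θ t x = 0

/-- The typed conclusion (`θ = 0`: scalings centred at the space-time origin) is formally STRONGER than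
the 8-dimensional one.  REMARK for the planner: a member of `A_C` symmetric ONLY under a spiral scaling
centred at a FUTURE time `t₀ > 0` (`σ ≠ 0`, `θ = −2σt₀`) would satisfy `HasSimSymmetry8` but not
`HasSimSymmetry`, i.e. it falsifies the typed `ForcedSymmetry` while being "symmetric" in the card's
informal sense.  Modulo `SymmetricLiouville` this is immaterial (its self-similar extension to `(−∞, t₀)`
shifted by `t₀` is a nonzero member of `A_C`, same `C`, with a CENTRED symmetry), so `X ⇔ FS ∧ SL` is
unaffected; interior centres `t₀ < 0` are trivial (boundedness of `u` near the centre forces `u ≡ 0` on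
`t < t₀` by letting the scale `λ → 0`, and uniqueness of bounded mild solutions from zero data gives
`t > t₀`), and the pure
time shift (`σ = 0, a = 0, A = 0, θ ≠ 0`) is never a symmetry of a nonzero member
(`vanishes_of_steady`).  The weakest faithful typing of the crux would use `simGen8`. -/
theorem hasSimSymmetry8_of_hasSimSymmetry {u : ℝ → EuclideanSpace ℝ (Fin 3) → EuclideanSpace ℝ (Fin 3)}
    (h : HasSimSymmetry u) : HasSimSymmetry8 u := by
  obtain ⟨a, σ, A, hA, hne, hL⟩ := h
  refine ⟨a, σ, A, 0, hA, fun h0 => hne ⟨h0.1, h0.2.1, h0.2.2.1⟩, fun t ht x => ?_⟩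
  simp [simGen8, hL t ht x]

/-- **Steady Type-I fields vanish**: a member of the class invariant under the pure time shift
(`∂_t u ≡ 0` on `t < 0`) is `0` — `u(t,x) = u(s,x)` for all `s < 0` (mean value theorem on the
time line, differentiability from H1) and `‖u(s,x)‖ ≤ C/√(−s) → 0` as `s → −∞` (H4).  So the 8th
generator alone never stabilises a nonzero member; H2, H3 unused. -/
theorem vanishes_of_steady {C : ℝ} {u : ℝ → EuclideanSpace ℝ (Fin 3) → EuclideanSpace ℝ (Fin 3)}
    (h1 : H1 u) (h4 : H4 C u) (hst : ∀ t < 0, ∀ x, timeDeriv u t x = 0) : ∀ t < 0, ∀ x, u t x = 0 := by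
  intro t ht x
  have hd : DifferentiableOn ℝ (fun s : ℝ => u s x) (Iio 0) := by
    have h1' : DifferentiableOn ℝ (Function.uncurry u) (Iio 0 ×ˢ univ) := h1.differentiableOn (by simp)
    have hp : DifferentiableOn ℝ (fun s : ℝ => (s, x)) (Iio 0) :=
      differentiableOn_id.prodMk (differentiableOn_const x)
    exact h1'.comp hp fun s hs => ⟨hs, mem_univ _⟩
  have hconst : ∀ s < 0, u s x = u t x := fun s hs =>
    isOpen_Iio.is_const_of_deriv_eq_zero isPreconnected_Iio hd (fun r hr => hst r hr x) hs ht
  rcases le_or_gt C 0 with hC | hC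
  · exact vanishes_of_h4_nonpos hC h4 t ht x
  by_contra hne
  have hpos : 0 < ‖u t x‖ := norm_pos_iff.2 hne
  set s : ℝ := -((C / ‖u t x‖) ^ 2 + 1) with hs
  have hs0 : s < 0 := by have := sq_nonneg (C / ‖u t x‖); rw [hs]; linarith
  have hb := h4 s hs0 x
  rw [hconst s hs0] at hb
  have hneg : -s = (C / ‖u t x‖) ^ 2 + 1 := by rw [hs, neg_neg]
  have hsq : C / ‖u t x‖ < Real.sqrt (-s) := by
    rw [hneg]
    calc C / ‖u t x‖ = Real.sqrt ((C / ‖u t x‖) ^ 2) := (Real.sqrt_sq (by positivity)).symm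
      _ < Real.sqrt ((C / ‖u t x‖) ^ 2 + 1) := Real.sqrt_lt_sqrt (sq_nonneg _) (by linarith)
  have hspos : 0 < Real.sqrt (-s) := Real.sqrt_pos.2 (by linarith)
  have hlt : C / Real.sqrt (-s) < ‖u t x‖ := by
    rw [div_lt_iff₀ hspos]
    rw [div_lt_iff₀ hpos] at hsq
    linarith [mul_comm (Real.sqrt (-s)) ‖u t x‖]
  linarith

/-! ## §7 Refutation criterion: what a disproof must produce -/

/-- Trivial stabiliser in `sim(3)`: no nonzero `ξ` annihilates `u`. -/
def TrivialStabiliser (u : ℝ → EuclideanSpace ℝ (Fin 3) → EuclideanSpace ℝ (Fin 3)) : Prop :=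
  ∀ (a : EuclideanSpace ℝ (Fin 3)) (σ : ℝ) (A : EuclideanSpace ℝ (Fin 3) →L[ℝ] EuclideanSpace ℝ (Fin 3)),
    (∀ x, inner ℝ (A x) x = 0) → (∀ t < 0, ∀ x, simGen u a σ A t x = 0) → a = 0 ∧ σ = 0 ∧ A = 0

/-- `¬ HasSimSymmetry u ↔ TrivialStabiliser u`. -/
theorem not_hasSimSymmetry_iff (u : ℝ → EuclideanSpace ℝ (Fin 3) → EuclideanSpace ℝ (Fin 3)) :
    ¬ HasSimSymmetry u ↔ TrivialStabiliser u := by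
  constructor
  · intro h a σ A hA hL
    by_contra hne
    exact h ⟨a, σ, A, hA, hne, hL⟩
  · rintro h ⟨a, σ, A, hA, hne, hL⟩
    exact hne (h a σ A hA hL)

/-- **Refutation criterion.** `¬ ForcedSymmetry` iff some member of some `A_C` has trivial stabiliser
(the witness `w` of §3 has trivial stabiliser but is not KNSS-mild). -/
theorem not_forcedSymmetry_iff :
    ¬ ForcedSymmetry ↔ ∃ (C : ℝ) (u : ℝ → EuclideanSpace ℝ (Fin 3) → EuclideanSpace ℝ (Fin 3)),
      InClassA C u ∧ TrivialStabiliser u := by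
  constructor
  · intro h
    by_contra hc
    push Not at hc
    exact h fun C u hu => by
      by_contra hns
      exact hc C u hu ((not_hasSimSymmetry_iff u).1 hns)
  · rintro ⟨C, u, hu, hts⟩ hFS
    exact (not_hasSimSymmetry_iff u).2 hts (hFS C u hu)

/-- **Any counterexample is a NONZERO Type-I KNSS-mild ancient field with LARGE constant** `C > ε`
(§5) and trivial stabiliser — i.e. at least a solution of the open Type-I Liouville problem `¬X`, and
moreover one outside every symmetric sub-case. -/
theorem not_forcedSymmetry_witness (h : ¬ ForcedSymmetry) :
    ∃ ε : ℝ, 0 < ε ∧ ∃ (C : ℝ) (u : ℝ → EuclideanSpace ℝ (Fin 3) → EuclideanSpace ℝ (Fin 3)),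
      ε < C ∧ InClassA C u ∧ TrivialStabiliser u ∧ ∃ t < 0, ∃ x, u t x ≠ 0 := by
  obtain ⟨ε, hε, hsmall⟩ := exists_eps_inClassA_vanishes
  obtain ⟨C, u, hu, hts⟩ := not_forcedSymmetry_iff.1 h
  have hnz : ∃ t < 0, ∃ x, u t x ≠ 0 := by
    by_contra hz
    push Not at hz
    exact (not_hasSimSymmetry_iff u).2 hts (hasSimSymmetry_of_vanishes hz)
  refine ⟨ε, hε, C, u, ?_, hu, hts, hnz⟩
  by_contra hle
  push Not at hle
  obtain ⟨t, ht, x, hx⟩ := hnz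
  exact hx (hsmall C u hle hu t ht x)

/-- `¬ ForcedSymmetry ⇒ ¬ X` (contrapositive of §4). -/
theorem not_typeIAncientLiouville_of_not_forcedSymmetry (h : ¬ ForcedSymmetry) : ¬ TypeIAncientLiouville :=
  fun hX => h (forcedSymmetry_of_typeIAncientLiouville hX)


/-! ## §8 Targets — line `time-anchor-bootstrap` (picked): census lemmas and tightness of the vertex lemma

-- Targets (stubs of skeleton 23c958e3…): stub_extendedForcedSymmetry (⇔ crux; false without H3, drefute),
-- stub_futureVertexLiouvilleIrrotational (true on paper; false without H3, drefute),
-- stub_futureVertexLiouvilleRotated (OPEN: bounded-profile backward RSS Liouville; false without H3, drefute),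
-- stub_interiorVertexVanishing (PROVED p76364; `θ ≤ T` necessary without H3 — below),
-- stub_rigidComotionVanishing (PROVED p76798; false without H4 — constants, drefute).  No stub is killed.
-/

/-! ### Census: fields with an obvious continuous symmetry satisfy the conclusion by definition -/

/-- Directional derivatives along a direction of translation invariance vanish (no differentiability
needed: where `v` is not differentiable `fderiv` is the junk `0`). -/
theorem fderiv_apply_eq_zero_of_translation_invariant {v : EuclideanSpace ℝ (Fin 3) → EuclideanSpace ℝ (Fin 3)}
    {e : EuclideanSpace ℝ (Fin 3)} (h : ∀ (x : EuclideanSpace ℝ (Fin 3)) (δ : ℝ), v (x + δ • e) = v x)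
    (x : EuclideanSpace ℝ (Fin 3)) : fderiv ℝ v x e = 0 := by
  by_cases hd : DifferentiableAt ℝ v x
  · have hline : HasDerivAt (fun δ : ℝ => x + δ • e) e 0 := by
      simpa using ((hasDerivAt_id (0 : ℝ)).smul_const e).const_add x
    have hd0 : HasFDerivAt v (fderiv ℝ v x) (x + (0 : ℝ) • e) := by simpa using hd.hasFDerivAt
    have hcomp : HasDerivAt (fun δ : ℝ => v (x + δ • e)) (fderiv ℝ v x e) 0 := hd0.comp_hasDerivAt 0 hline
    have hconst : (fun δ : ℝ => v (x + δ • e)) = fun _ => v x := funext fun δ => h x δ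
    rw [hconst] at hcomp
    exact hcomp.unique (hasDerivAt_const 0 (v x)) ▸ rfl
  · rw [fderiv_zero_of_not_differentiableAt hd]; rfl

/-- **Census lemma: translation-invariant fields are symmetric.**  A field invariant (slice-wise on
`t < 0`) under the translations along a nonzero `e` carries the crux's conclusion with `ξ = (e, 0, 0)`. -/
theorem hasSimSymmetry_of_translation_invariant {u : ℝ → EuclideanSpace ℝ (Fin 3) → EuclideanSpace ℝ (Fin 3)}
    {e : EuclideanSpace ℝ (Fin 3)} (he : e ≠ 0)
    (h : ∀ t < 0, ∀ (x : EuclideanSpace ℝ (Fin 3)) (δ : ℝ), u t (x + δ • e) = u t x) : HasSimSymmetry u := by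
  refine ⟨e, 0, 0, fun x => by simp, fun hh => he hh.1, fun t ht x => ?_⟩
  simp [simGen, fderiv_apply_eq_zero_of_translation_invariant (h t ht) x]

/-- In particular a field independent of one Cartesian coordinate (every shear, unidirectional or
2.5-dimensional flow) is symmetric: such fields can never refute the crux, whatever class they lie in. -/
theorem hasSimSymmetry_of_indep_coord {u : ℝ → EuclideanSpace ℝ (Fin 3) → EuclideanSpace ℝ (Fin 3)} (i : Fin 3)
    (h : ∀ t < 0, ∀ (x : EuclideanSpace ℝ (Fin 3)) (δ : ℝ), u t (x + EuclideanSpace.single i δ) = u t x) :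
    HasSimSymmetry u := by
  refine hasSimSymmetry_of_translation_invariant (e := EuclideanSpace.single i (1 : ℝ)) ?_ fun t ht x δ => ?_
  · intro h0
    have := congrArg (fun v : EuclideanSpace ℝ (Fin 3) => v i) h0
    simp at this
  · have : (δ : ℝ) • EuclideanSpace.single i (1 : ℝ) = EuclideanSpace.single i δ := by
      ext j
      by_cases hj : j = i
      · subst hj; simp
      · simp [hj]
    rw [this]; exact h t ht x δ

/-- The rotation by the angle `φ` about the `e₂`-axis, written through its generator `rot`
(`rot x = e₂ × x`): `Rz φ x = x + (cos φ − 1)(x₀e₀ + x₁e₁) + sin φ · rot x`. -/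
def Rz (φ : ℝ) (x : EuclideanSpace ℝ (Fin 3)) : EuclideanSpace ℝ (Fin 3) :=
  x + (Real.cos φ - 1) • (x 0 • e0 + x 1 • e1) + Real.sin φ • rot x

@[simp] theorem Rz_zero (x : EuclideanSpace ℝ (Fin 3)) : Rz 0 x = x := by simp [Rz]

/-- `φ ↦ Rz φ v` has velocity `rot v` at `φ = 0`. -/
theorem hasDerivAt_Rz (v : EuclideanSpace ℝ (Fin 3)) : HasDerivAt (fun φ => Rz φ v) (rot v) 0 := by
  have h1 : HasDerivAt (fun φ => (Real.cos φ - 1) • (v 0 • e0 + v 1 • e1)) ((-Real.sin 0) • (v 0 • e0 + v 1 • e1)) 0 :=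
    ((Real.hasDerivAt_cos 0).sub_const 1).smul_const _
  have h2 : HasDerivAt (fun φ => Real.sin φ • rot v) (Real.cos 0 • rot v) 0 :=
    (Real.hasDerivAt_sin 0).smul_const _
  have h := (h1.const_add v).add h2
  simp only [Real.sin_zero, neg_zero, zero_smul, Real.cos_zero, one_smul, zero_add] at h
  exact h

/-- **Census lemma: axisymmetric fields are symmetric.** A field whose slices on `t < 0` are
differentiable and equivariant under the rotations about an axis (`u(R_φ x) = R_φ u(x)`, with or
without swirl) carries the crux's conclusion with `ξ = (0, 0, rot)`: differentiate the equivariance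
at `φ = 0`.  (Helical = screw-equivariant fields are handled identically with `ξ = (κe₂, 0, rot)`.)
So axisymmetric and helical Type-I ancient solutions — the two leaves the sibling crux
`SymmetricLiouville` must kill — can never refute `ForcedSymmetry`; only a field with NO continuous
Euclidean/similarity symmetry can. -/
theorem hasSimSymmetry_of_axisymmetric {u : ℝ → EuclideanSpace ℝ (Fin 3) → EuclideanSpace ℝ (Fin 3)}
    (hd : ∀ t < 0, Differentiable ℝ (u t))
    (h : ∀ t < 0, ∀ (φ : ℝ) (x : EuclideanSpace ℝ (Fin 3)), u t (Rz φ x) = Rz φ (u t x)) : HasSimSymmetry u := by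
  refine ⟨0, 0, rot, inner_rot_self, fun hh => ?_, fun t ht x => ?_⟩
  · have h0 := congrArg (fun A : EuclideanSpace ℝ (Fin 3) →L[ℝ] EuclideanSpace ℝ (Fin 3) => A e0) hh.2.2
    simp only [rot_e0, zero_apply] at h0
    exact e1_ne_zero h0
  · -- differentiate `φ ↦ u t (Rz φ x) = Rz φ (u t x)` at `φ = 0`
    have hL : HasDerivAt (fun φ => u t (Rz φ x)) (fderiv ℝ (u t) x (rot x)) 0 := by
      have hu : HasFDerivAt (u t) (fderiv ℝ (u t) x) (Rz 0 x) := by simpa using ((hd t ht) x).hasFDerivAt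
      exact hu.comp_hasDerivAt 0 (hasDerivAt_Rz x)
    have hR : HasDerivAt (fun φ => Rz φ (u t x)) (rot (u t x)) 0 := hasDerivAt_Rz (u t x)
    have hfun : (fun φ => u t (Rz φ x)) = fun φ => Rz φ (u t x) := funext (h t ht · x)
    rw [hfun] at hL
    have heq : fderiv ℝ (u t) x (rot x) = rot (u t x) := hL.unique hR
    simp [simGen, heq]

/-! ### Tightness of the vertex lemma (stub 3) in the H3-free class: the vertex must lie in the closed end -/

/-- The glue `vtxGlue t = (−1 − t)(1 − S(2(t+2))) + S(2(t+2))`, `S = Real.smoothTransition`: smooth,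
`vtxGlue t = −1 − t` for `t ≤ −2`, `vtxGlue t = 1` for `t ≥ −3/2`, `vtxGlue ≥ 1/2` and `vtxGlue t ≥ (−t)/4` everywhere. -/
def vtxGlue (t : ℝ) : ℝ :=
  (-1 - t) * (1 - Real.smoothTransition (2 * (t + 2))) + Real.smoothTransition (2 * (t + 2))

theorem vtxGlue_of_le {t : ℝ} (ht : t ≤ -2) : vtxGlue t = -1 - t := by
  have h0 : Real.smoothTransition (2 * (t + 2)) = 0 := Real.smoothTransition.zero_of_nonpos (by linarith)
  simp [vtxGlue, h0]

theorem vtxGlue_of_ge {t : ℝ} (ht : -3 / 2 ≤ t) : vtxGlue t = 1 := by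
  have h1 : Real.smoothTransition (2 * (t + 2)) = 1 := Real.smoothTransition.one_of_one_le (by linarith)
  simp [vtxGlue, h1]

theorem half_le_vtxGlue (t : ℝ) : 1 / 2 ≤ vtxGlue t := by
  rcases le_or_gt t (-3 / 2) with h | h
  · have h0 := Real.smoothTransition.nonneg (2 * (t + 2))
    have h1 := Real.smoothTransition.le_one (2 * (t + 2))
    unfold vtxGlue
    nlinarith
  · rw [vtxGlue_of_ge h.le]; norm_num

theorem vtxGlue_pos (t : ℝ) : 0 < vtxGlue t := by linarith [half_le_vtxGlue t]

theorem neg_div_four_le_vtxGlue (t : ℝ) : -t / 4 ≤ vtxGlue t := by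
  rcases le_or_gt t (-2) with h | h
  · rw [vtxGlue_of_le h]; linarith
  · linarith [half_le_vtxGlue t]

theorem contDiff_vtxGlue : ContDiff ℝ (⊤ : ℕ∞) vtxGlue := by
  have hS : ContDiff ℝ (⊤ : ℕ∞) (fun t : ℝ => Real.smoothTransition (2 * (t + 2))) :=
    Real.smoothTransition.contDiff.comp (contDiff_const.mul (contDiff_id.add contDiff_const))
  have : vtxGlue = fun t => (-1 - t) * (1 - Real.smoothTransition (2 * (t + 2))) + Real.smoothTransition (2 * (t + 2)) := rfl
  rw [this]
  exact ((contDiff_const.sub contDiff_id).mul (contDiff_const.sub hS)).add hS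

/-- The glued clock `vtxClock t = vtxGlue(t)^{-1/2}`: equal to `(−1 − t)^{-1/2}` (self-similar about the vertex
`θ = −1`) on the end `t ≤ −2`, smooth and positive on the whole line, `vtxClock t ≤ 2/√(−t)` on `t < 0`. -/
def vtxClock (t : ℝ) : ℝ := (Real.sqrt (vtxGlue t))⁻¹

theorem contDiff_vtxClock : ContDiff ℝ (⊤ : ℕ∞) vtxClock :=
  (contDiff_vtxGlue.sqrt fun t => (vtxGlue_pos t).ne').inv fun t => (Real.sqrt_pos.2 (vtxGlue_pos t)).ne'

theorem vtxClock_pos (t : ℝ) : 0 < vtxClock t := inv_pos.2 (Real.sqrt_pos.2 (vtxGlue_pos t))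

theorem vtxClock_le {t : ℝ} (ht : t < 0) : vtxClock t ≤ 2 / Real.sqrt (-t) := by
  have hq : Real.sqrt (-t / 4) = Real.sqrt (-t) / 2 := by
    rw [Real.sqrt_div' _ (by norm_num : (0:ℝ) ≤ 4)]
    congr 1
    rw [show (4 : ℝ) = 2 ^ 2 by norm_num, Real.sqrt_sq (by norm_num : (0:ℝ) ≤ 2)]
  have hpos : 0 < Real.sqrt (-t) / 2 := by
    have := Real.sqrt_pos.2 (show 0 < -t by linarith); linarith
  have hle : Real.sqrt (-t) / 2 ≤ Real.sqrt (vtxGlue t) := by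
    rw [← hq]; exact Real.sqrt_le_sqrt (neg_div_four_le_vtxGlue t)
  calc vtxClock t = (Real.sqrt (vtxGlue t))⁻¹ := rfl
    _ ≤ (Real.sqrt (-t) / 2)⁻¹ := inv_anti₀ hpos hle
    _ = 2 / Real.sqrt (-t) := by rw [inv_div]

/-- Derivative of the clock on the end: for `t < −2`, `vtxClock' t = 1/(2 (−1−t) √(−1−t))`. -/
theorem hasDerivAt_vtxClock {t : ℝ} (ht : t < -2) :
    HasDerivAt vtxClock (1 / (2 * (-1 - t) * Real.sqrt (-1 - t))) t := by
  have hg : vtxGlue t = -1 - t := vtxGlue_of_le ht.le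
  have hlin : HasDerivAt (fun s : ℝ => -1 - s) (-1) t := by
    simpa using (hasDerivAt_id t).const_sub (-1)
  have hEq : vtxGlue =ᶠ[𝓝 t] fun s => -1 - s :=
    Filter.eventually_of_mem (Iio_mem_nhds ht) fun s hs => vtxGlue_of_le (le_of_lt hs)
  have hgl : HasDerivAt vtxGlue (-1) t := hlin.congr_of_eventuallyEq hEq
  have hpos : 0 < -1 - t := by linarith
  have hsq : HasDerivAt (fun s => Real.sqrt (vtxGlue s)) ((-1) / (2 * Real.sqrt (vtxGlue t))) t :=
    hgl.sqrt (vtxGlue_pos t).ne'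
  have hne : Real.sqrt (vtxGlue t) ≠ 0 := (Real.sqrt_pos.2 (vtxGlue_pos t)).ne'
  have hinv := hsq.inv hne
  have hval : -(-1 / (2 * Real.sqrt (vtxGlue t))) / Real.sqrt (vtxGlue t) ^ 2 = 1 / (2 * (-1 - t) * Real.sqrt (-1 - t)) := by
    rw [hg, Real.sq_sqrt hpos.le]
    field_simp
  rw [hval] at hinv
  exact hinv

/-- The glued witness `vtxWit t x = vtxClock t • e₀` (constant in space). -/
def vtxWit (t : ℝ) (_x : EuclideanSpace ℝ (Fin 3)) : EuclideanSpace ℝ (Fin 3) := vtxClock t • e0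

theorem vtxWit_h1 : H1 vtxWit :=
  ((contDiff_vtxClock.comp contDiff_fst).smul contDiff_const).contDiffOn

theorem vtxWit_h2 : H2 vtxWit := by
  intro t _ x
  have : vtxWit t = fun _ => vtxClock t • e0 := rfl
  simp [VectorCalculus.divergence, this]

theorem vtxWit_h4 : H4 2 vtxWit := by
  intro t ht x
  have : ‖vtxWit t x‖ = vtxClock t := by
    simp [vtxWit, norm_smul, e0, abs_of_pos (vtxClock_pos t)]
  rw [this]
  exact vtxClock_le ht

theorem timeDeriv_vtxWit {t : ℝ} (ht : t < -2) (x : EuclideanSpace ℝ (Fin 3)) :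
    timeDeriv vtxWit t x = (1 / (2 * (-1 - t) * Real.sqrt (-1 - t))) • e0 :=
  ((hasDerivAt_vtxClock ht).smul_const e0).deriv

theorem vtxClock_of_lt {t : ℝ} (ht : t < -2) : vtxClock t = (Real.sqrt (-1 - t))⁻¹ := by
  simp [vtxClock, vtxGlue_of_le ht.le]

/-- On the end `t < −2` the witness is annihilated by the scaling generator about the vertex
`(θ, x_c) = (−1, 0)` (`σ = 1`, `a = 0`, `A = 0`): `∇vtxWit·x + vtxWit + 2(t+1)∂ₜuc = 0`. -/
theorem vtxWit_generator {t : ℝ} (ht : t < -2) (x : EuclideanSpace ℝ (Fin 3)) :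
    fderiv ℝ (vtxWit t) x ((0 : EuclideanSpace ℝ (Fin 3)) + (1 : ℝ) • x + (0 : EuclideanSpace ℝ (Fin 3) →L[ℝ] EuclideanSpace ℝ (Fin 3)) x)
      + (1 : ℝ) • vtxWit t x + (2 * (1 : ℝ) * (t - (-1))) • timeDeriv vtxWit t x
      - (0 : EuclideanSpace ℝ (Fin 3) →L[ℝ] EuclideanSpace ℝ (Fin 3)) (vtxWit t x) = 0 := by
  have hfd : fderiv ℝ (vtxWit t) x = 0 := by
    have : vtxWit t = fun _ => vtxClock t • e0 := rfl
    rw [this]; exact fderiv_const_apply _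
  rw [hfd, timeDeriv_vtxWit ht x]
  simp only [zero_apply, zero_add, one_smul, sub_zero, vtxWit, vtxClock_of_lt ht, smul_smul, ← add_smul,
    one_mul]
  have hpos : 0 < -1 - t := by linarith
  have hs : Real.sqrt (-1 - t) ≠ 0 := (Real.sqrt_pos.2 hpos).ne'
  have : (Real.sqrt (-1 - t))⁻¹ + 2 * 1 * (t - -1) * (1 / (2 * (-1 - t) * Real.sqrt (-1 - t))) = 0 := by
    field_simp
    ring
  rw [this, zero_smul]

theorem vtxWit_ne_zero : vtxWit (-3) 0 ≠ 0 := by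
  simp [vtxWit, e0, (vtxClock_pos (-3)).ne']

/-- Stub 3 of line `time-anchor-bootstrap` (interior-vertex vanishing) with the Oseen clause H3 deleted
AND the vertex allowed OUTSIDE the closed end (`T < θ < 0` instead of `θ ≤ T`). -/
def VertexOutsideEndVanishingWithoutH3 : Prop :=
  ∀ (C : ℝ) (u : ℝ → EuclideanSpace ℝ (Fin 3) → EuclideanSpace ℝ (Fin 3)), H1 u → H2 u → H4 C u →
    ∀ (a : EuclideanSpace ℝ (Fin 3)) (σ : ℝ) (A : EuclideanSpace ℝ (Fin 3) →L[ℝ] EuclideanSpace ℝ (Fin 3)) (θ T : ℝ),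
      (∀ x, inner ℝ (A x) x = 0) → σ ≠ 0 → θ < 0 → T < θ → T ≤ 0 →
      (∀ t < T, ∀ x, fderiv ℝ (u t) x (a + σ • x + A x) + σ • u t x +
        (2 * σ * (t - θ)) • timeDeriv u t x - A (u t x) = 0) →
      ∀ t < T, ∀ x, u t x = 0

/-- **Tightness of the vertex lemma.** In the H3-free class (smooth, divergence free, Type-I) the
interior-vertex vanishing statement is FALSE as soon as the vertex `θ < 0` is allowed to lie OUTSIDE
the closed end `t ≤ T` on which the generator identity holds: the glued parasitic soliton
`vtxWit t x = vtxClock t • e₀`, `vtxClock = (−1 − t)^{-1/2}` on `t ≤ −2` and smoothly capped (`Real.smoothTransition`)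
before the vertex `θ = −1`, is smooth on the whole slab, divergence free, obeys `‖vtxWit‖ ≤ 2/√(−t)`, is
annihilated on `t < T = −2` by the scaling generator about `(−1, 0)`, and does not vanish there.
So the elementary characteristic argument of stub 3 (which uses H1 only and runs INTO the vertex)
genuinely needs `θ ≤ T`; for a vertex in `(T, 0)` any vanishing statement must use the Oseen clause H3
(irrotational leaf: Tsai + the gauge on the end; rotated leaf: the open RSS-Liouville, as in stub 2b). -/
theorem vertexOutsideEnd_false_without_H3 : ¬ VertexOutsideEndVanishingWithoutH3 := by
  intro h
  have h0 := h 2 vtxWit vtxWit_h1 vtxWit_h2 vtxWit_h4 0 1 0 (-1) (-2) (fun x => by simp) one_ne_zero (by norm_num)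
    (by norm_num) (by norm_num) (fun t ht x => vtxWit_generator ht x) (-3) (by norm_num) 0
  exact vtxWit_ne_zero h0

/-! ## §10 Discrete self-similarity does not force a continuous symmetry (kinematic λ-DSS witness)

The real threat to the crux is a backward DISCRETELY self-similar Type-I ancient solution that is not
(rotated-)self-similar (Bradshaw–Tsai 2017 OP 5.1).  Its kinematic shadow is checkable: in the H3-free
class (smooth, divergence free, Type-I) there are λ-DSS fields with TRIVIAL `sim(3)`-stabiliser.  So the
typed side conditions together with discrete self-similarity do not produce the `∃ ξ` of the crux; only the
Oseen identity of `u` itself could. -/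

section RigidOfR

variable {a : EuclideanSpace ℝ (Fin 3)} {A : EuclideanSpace ℝ (Fin 3) →L[ℝ] EuclideanSpace ℝ (Fin 3)}

/-- The polynomial symmetry defect `R a A` of the profile `V` determines `(a, A)`: if `A` is skew and
`R a A ≡ 0` then all twelve coordinates of `(a, A e₀, A e₁, A e₂)` vanish (the computation inside
`coords_eq_zero`, with the defect hypothesis abstracted so that other clocks can reuse it). -/
theorem coords_eq_zero_of_R (hA : ∀ x, inner ℝ (A x) x = 0) (hR : ∀ x, R a A x = 0) :
    (a 0 = 0 ∧ a 1 = 0 ∧ a 2 = 0) ∧ (A e0 0 = 0 ∧ A e0 1 = 0 ∧ A e0 2 = 0) ∧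
      (A e1 0 = 0 ∧ A e1 1 = 0 ∧ A e1 2 = 0) ∧ (A e2 0 = 0 ∧ A e2 1 = 0 ∧ A e2 2 = 0) := by
  have d0 : A e0 0 = 0 := skew_diag hA 0
  have d1 : A e1 1 = 0 := skew_diag hA 1
  have d2 : A e2 2 = 0 := skew_diag hA 2
  have o01 : A e1 0 = - A e0 1 := skew_off hA 0 1
  have o02 : A e2 0 = - A e0 2 := skew_off hA 0 2
  have o12 : A e2 1 = - A e1 2 := skew_off hA 1 2
  have r0 := hR 0
  have r2 := hR e2
  have r2' := hR (-e2)
  have r1 := hR e0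
  simp only [R, map_zero, add_zero, P_zero, smul_zero, sub_zero, P_e2, P_neg_e2, map_neg, P_e0] at r0 r2 r2' r1
  have c00 := congrArg (fun v : EuclideanSpace ℝ (Fin 3) => v 0) r0
  have c01 := congrArg (fun v : EuclideanSpace ℝ (Fin 3) => v 1) r0
  have c20 := congrArg (fun v : EuclideanSpace ℝ (Fin 3) => v 0) r2
  have c2'1 := congrArg (fun v : EuclideanSpace ℝ (Fin 3) => v 1) r2'
  have c11 := congrArg (fun v : EuclideanSpace ℝ (Fin 3) => v 1) r1
  have c12 := congrArg (fun v : EuclideanSpace ℝ (Fin 3) => v 2) r1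
  simp only [DP_c0, DP_c1, DP_c2, PiLp.add_apply, PiLp.sub_apply, PiLp.neg_apply, PiLp.smul_apply,
    PiLp.zero_apply, smul_eq_mul, e0_c0, e0_c1, e0_c2, e1_c1, e1_c2, e2_c0, e2_c2,
    inner_e0_left] at c00 c01 c20 c2'1 c11 c12
  have ha1 : a 1 = 0 := by linarith
  have ha0 : a 0 = 0 := by nlinarith
  have h21 : A e2 1 = 0 := by linarith
  have h20 : A e2 0 = 0 := by nlinarith
  have h02 : A e0 2 = 0 := by linarith
  have ha2 : a 2 = 0 := by nlinarith
  have h12 : A e1 2 = 0 := by linarith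
  have h01 : A e0 1 = 0 := by nlinarith
  refine ⟨⟨ha0, ha1, ha2⟩, ⟨d0, h01, h02⟩, ⟨by linarith, d1, h12⟩, ⟨h20, h21, d2⟩⟩

/-- `R a A ≡ 0` with `A` skew forces `a = 0` and `A = 0`. -/
theorem rigid_of_R (hA : ∀ x, inner ℝ (A x) x = 0) (hR : ∀ x, R a A x = 0) : a = 0 ∧ A = 0 := by
  obtain ⟨⟨ha0, ha1, ha2⟩, ⟨h00, h01, h02⟩, ⟨h10, h11, h12⟩, ⟨h20, h21, h22⟩⟩ := coords_eq_zero_of_R hA hR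
  refine ⟨?_, ?_⟩
  · ext i; fin_cases i <;> simp [ha0, ha1, ha2]
  · have hA0 : A e0 = 0 := by ext i; fin_cases i <;> simp [h00, h01, h02]
    have hA1 : A e1 = 0 := by ext i; fin_cases i <;> simp [h10, h11, h12]
    have hA2 : A e2 = 0 := by ext i; fin_cases i <;> simp [h20, h21, h22]
    refine ContinuousLinearMap.coe_inj.1 ((EuclideanSpace.basisFun (Fin 3) ℝ).toBasis.ext fun i => ?_)
    fin_cases i
    · simpa [e0] using hA0
    · simpa [e1] using hA1
    · simpa [e2] using hA2

/-- At `σ = 0` the defect of `V` is `DV y a + (DV y (A y) − A (V y)) = gauss y • R a A y`. -/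
theorem DV_add_defect_eq (a : EuclideanSpace ℝ (Fin 3)) (A : EuclideanSpace ℝ (Fin 3) →L[ℝ] EuclideanSpace ℝ (Fin 3))
    (y : EuclideanSpace ℝ (Fin 3)) : DV y a + (DV y (A y) - A (V y)) = gauss y • R a A y := by
  rw [← core_zero_sigma]
  simp only [core, zero_smul, add_zero, map_add]
  abel

end RigidOfR

/-! ### The λ-DSS witness `ud t x = (2 + sin log(−t)) (−t)^{-1/2} V(x/√(−t))` -/

/-- The log-periodic modulation `dm t = 2 + sin(log(−t))`. -/
def dm (t : ℝ) : ℝ := 2 + Real.sin (Real.log (-t))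

/-- The similarity radius `sr t = (−t)^{-1/2}`. -/
def sr (t : ℝ) : ℝ := (Real.sqrt (-t))⁻¹

/-- **The λ-DSS witness** `ud t x = dm t · sr t · V (sr t • x)`: self-similar up to the log-periodic
factor `dm`, hence discretely self-similar with factor `λ = e^{π}` but NOT self-similar. -/
def ud (t : ℝ) (x : EuclideanSpace ℝ (Fin 3)) : EuclideanSpace ℝ (Fin 3) := (dm t * sr t) • V (sr t • x)

theorem sr_pos {t : ℝ} (ht : t < 0) : 0 < sr t := inv_pos.2 (Real.sqrt_pos.2 (by linarith))

theorem abs_dm_le (t : ℝ) : |dm t| ≤ 3 := by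
  have h1 := Real.sin_le_one (Real.log (-t))
  have h2 := Real.neg_one_le_sin (Real.log (-t))
  rw [dm, abs_le]; constructor <;> linarith

theorem sr_mul_sqrt {t : ℝ} (ht : t < 0) : sr t * Real.sqrt (-t) = 1 :=
  inv_mul_cancel₀ (Real.sqrt_pos.2 (by linarith)).ne'

/-- Discrete self-similarity: `ud (e^{2π} t) (e^{π} x) = e^{−π} ud t x` on `t < 0`. -/
theorem ud_dss {t : ℝ} (ht : t < 0) (x : EuclideanSpace ℝ (Fin 3)) :
    ud (Real.exp (2 * Real.pi) * t) (Real.exp Real.pi • x) = Real.exp (-Real.pi) • ud t x := by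
  have hE : 0 < Real.exp (2 * Real.pi) := Real.exp_pos _
  have hdm : dm (Real.exp (2 * Real.pi) * t) = dm t := by
    simp only [dm]
    rw [show -(Real.exp (2 * Real.pi) * t) = Real.exp (2 * Real.pi) * (-t) by ring,
      Real.log_mul hE.ne' (by linarith : -t ≠ 0), Real.log_exp, add_comm (2 * Real.pi), Real.sin_add_two_pi]
  have hsq : Real.sqrt (Real.exp (2 * Real.pi)) = Real.exp Real.pi := by
    rw [show Real.exp (2 * Real.pi) = Real.exp Real.pi ^ 2 by rw [← Real.exp_nat_mul]; ring_nf,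
      Real.sqrt_sq (Real.exp_pos _).le]
  have hsr : sr (Real.exp (2 * Real.pi) * t) = Real.exp (-Real.pi) * sr t := by
    simp only [sr]
    rw [show -(Real.exp (2 * Real.pi) * t) = Real.exp (2 * Real.pi) * (-t) by ring,
      Real.sqrt_mul hE.le, hsq, mul_inv, Real.exp_neg]
  simp only [ud, hdm, hsr, smul_smul]
  have h1 : Real.exp (-Real.pi) * sr t * Real.exp Real.pi = sr t := by
    rw [Real.exp_neg]; field_simp
  rw [h1]
  congr 1
  ring

/-! ### Derivatives -/

theorem hasFDerivAt_ud (t : ℝ) (x : EuclideanSpace ℝ (Fin 3)) :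
    HasFDerivAt (ud t) ((dm t * sr t * sr t) • DV (sr t • x)) x := by
  have h1 : HasFDerivAt (fun x : EuclideanSpace ℝ (Fin 3) => sr t • x) (sr t • ContinuousLinearMap.id ℝ _) x :=
    (hasFDerivAt_id x).const_smul (sr t)
  have h2 := ((hasFDerivAt_V (sr t • x)).comp x h1).const_smul (dm t * sr t)
  have he : (dm t * sr t) • (DV (sr t • x)).comp (sr t • ContinuousLinearMap.id ℝ (EuclideanSpace ℝ (Fin 3))) =
      (dm t * sr t * sr t) • DV (sr t • x) := by
    ext h
    simp [smul_smul, mul_comm, mul_left_comm]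
  rw [← he]
  exact h2

theorem fderiv_ud (t : ℝ) (x : EuclideanSpace ℝ (Fin 3)) :
    fderiv ℝ (ud t) x = (dm t * sr t * sr t) • DV (sr t • x) :=
  (hasFDerivAt_ud t x).fderiv

theorem hasDerivAt_sr {t : ℝ} (ht : t < 0) : HasDerivAt sr (sr t ^ 3 / 2) t := by
  have hq : 0 < Real.sqrt (-t) := Real.sqrt_pos.2 (by linarith)
  have h1 : HasDerivAt (fun s : ℝ => Real.sqrt (-s)) ((-1) / (2 * Real.sqrt (-t))) t :=
    (hasDerivAt_neg t).sqrt (by linarith)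
  have h2 := h1.inv hq.ne'
  have hval : -(-1 / (2 * Real.sqrt (-t))) / Real.sqrt (-t) ^ 2 = sr t ^ 3 / 2 := by
    simp only [sr]
    field_simp
  rw [hval] at h2
  exact h2

theorem hasDerivAt_dm {t : ℝ} (ht : t < 0) : HasDerivAt dm (Real.cos (Real.log (-t)) * t⁻¹) t := by
  have h1 : HasDerivAt (fun s : ℝ => Real.log (-s)) ((-t)⁻¹ * (-1)) t :=
    (Real.hasDerivAt_log (by linarith : -t ≠ 0)).comp t (hasDerivAt_neg t)
  have h2 := (Real.hasDerivAt_sin _).comp t h1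
  have h3 := h2.const_add 2
  have hval : Real.cos (Real.log (-t)) * ((-t)⁻¹ * -1) = Real.cos (Real.log (-t)) * t⁻¹ := by
    rw [inv_neg]; ring
  rw [hval] at h3
  exact h3

theorem hasDerivAt_ud_time {t : ℝ} (ht : t < 0) (x : EuclideanSpace ℝ (Fin 3)) :
    HasDerivAt (fun s => ud s x)
      ((dm t * sr t) • DV (sr t • x) ((sr t ^ 3 / 2) • x) +
        (Real.cos (Real.log (-t)) * t⁻¹ * sr t + dm t * (sr t ^ 3 / 2)) • V (sr t • x)) t := by
  have hV : HasDerivAt (fun s => V (sr s • x)) (DV (sr t • x) ((sr t ^ 3 / 2) • x)) t := by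
    have := (hasFDerivAt_V (sr t • x)).comp_hasDerivAt t ((hasDerivAt_sr ht).smul_const x)
    simpa [Function.comp_def] using this
  exact ((hasDerivAt_dm ht).mul (hasDerivAt_sr ht)).smul hV

theorem timeDeriv_ud {t : ℝ} (ht : t < 0) (x : EuclideanSpace ℝ (Fin 3)) :
    timeDeriv ud t x = (dm t * sr t) • DV (sr t • x) ((sr t ^ 3 / 2) • x) +
        (Real.cos (Real.log (-t)) * t⁻¹ * sr t + dm t * (sr t ^ 3 / 2)) • V (sr t • x) :=
  (hasDerivAt_ud_time ht x).deriv

/-! ### The witness satisfies H1, H2, H4 -/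

theorem ud_h1 : H1 ud := by
  intro p hp
  have ht : p.1 < 0 := by simpa using hp.1
  have hsr : ContDiffAt ℝ (⊤ : ℕ∞) (fun q : ℝ × EuclideanSpace ℝ (Fin 3) => sr q.1) p := by
    have h1 : ContDiffAt ℝ (⊤ : ℕ∞) (fun q : ℝ × EuclideanSpace ℝ (Fin 3) => Real.sqrt (-q.1)) p :=
      contDiffAt_fst.neg.sqrt (by simp; linarith)
    exact h1.inv (Real.sqrt_pos.2 (by simp; linarith)).ne'
  have hdm : ContDiffAt ℝ (⊤ : ℕ∞) (fun q : ℝ × EuclideanSpace ℝ (Fin 3) => dm q.1) p := by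
    have h1 : ContDiffAt ℝ (⊤ : ℕ∞) (fun q : ℝ × EuclideanSpace ℝ (Fin 3) => Real.log (-q.1)) p :=
      contDiffAt_fst.neg.log (by simp; linarith)
    exact contDiffAt_const.add h1.sin
  have hV : ContDiffAt ℝ (⊤ : ℕ∞) (fun q : ℝ × EuclideanSpace ℝ (Fin 3) => V (sr q.1 • q.2)) p :=
    contDiff_V.contDiffAt.comp p (hsr.smul contDiffAt_snd)
  exact ((hdm.mul hsr).smul hV).contDiffWithinAt

/-- `tr DV(y) = 0`: the profile `V` is divergence free. -/
theorem sum_inner_DV (y : EuclideanSpace ℝ (Fin 3)) :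
    inner ℝ (EuclideanSpace.single 0 (1:ℝ) : EuclideanSpace ℝ (Fin 3)) (DV y (EuclideanSpace.single 0 1)) +
      inner ℝ (EuclideanSpace.single 1 (1:ℝ) : EuclideanSpace ℝ (Fin 3)) (DV y (EuclideanSpace.single 1 1)) +
      inner ℝ (EuclideanSpace.single 2 (1:ℝ) : EuclideanSpace ℝ (Fin 3)) (DV y (EuclideanSpace.single 2 1)) = 0 := by
  simp only [inner_single_one_left, DV_apply, PiLp.add_apply, PiLp.smul_apply, smul_eq_mul, DP_c0, DP_c1, DP_c2,
    P_c0, P_c1, P_c2, PiLp.single_apply, EuclideanSpace.inner_single_right]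
  simp
  ring

theorem ud_h2 : H2 ud := by
  intro t _ x
  have hb := divergence_eq_sum_inner_fderiv (EuclideanSpace.basisFun (Fin 3) ℝ) (ud t) x
  rw [hb, fderiv_ud, Fin.sum_univ_three]
  simp only [EuclideanSpace.basisFun_apply, smul_apply, real_inner_smul_right,
    ← mul_add]
  rw [sum_inner_DV, mul_zero]

theorem ud_h4 : H4 6 ud := by
  intro t ht x
  have hs := sr_pos ht
  have hq : 0 < Real.sqrt (-t) := Real.sqrt_pos.2 (by linarith)
  rw [ud, norm_smul, Real.norm_eq_abs, abs_mul, abs_of_pos hs]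
  have h1 : |dm t| * sr t * ‖V (sr t • x)‖ ≤ 3 * sr t * 2 := by
    gcongr
    · exact abs_dm_le t
    · exact norm_V_le _
  refine h1.trans (le_of_eq ?_)
  rw [sr, div_eq_mul_inv]
  ring

/-! ### Trivial stabiliser -/

/-- The generator on the witness, evaluated at `x = √(−t) • y`:
`√(−t) • L_ξ ud (t, √(−t)y) = dm t • (sr t • DV y a + (DV y (A y) − A (V y))) + (2σ cos log(−t)) • V y`. -/
theorem simGen_ud {t : ℝ} (ht : t < 0) (a : EuclideanSpace ℝ (Fin 3)) (σ : ℝ)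
    (A : EuclideanSpace ℝ (Fin 3) →L[ℝ] EuclideanSpace ℝ (Fin 3)) (y : EuclideanSpace ℝ (Fin 3)) :
    Real.sqrt (-t) • simGen ud a σ A t (Real.sqrt (-t) • y) =
      dm t • (sr t • DV y a + (DV y (A y) - A (V y))) + (2 * σ * Real.cos (Real.log (-t))) • V y := by
  set q : ℝ := Real.sqrt (-t) with hq_def
  have hq : 0 < q := Real.sqrt_pos.2 (by linarith)
  have hqq : q * q = -t := Real.mul_self_sqrt (by linarith)
  have hsq : sr t * q = 1 := sr_mul_sqrt ht
  have hsr : sr t = q⁻¹ := by rw [sr]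
  have hy : sr t • (q • y) = y := by rw [smul_smul, hsq, one_smul]
  unfold simGen
  rw [fderiv_ud, timeDeriv_ud ht, hy]
  simp only [ud, hy, smul_apply, map_add, map_smul, smul_add, smul_sub, smul_smul]
  rw [hsr]
  have ht' : t = -(q * q) := by linarith
  have hq0 : q ≠ 0 := hq.ne'
  rw [ht']
  match_scalars <;> field_simp <;> ring

variable {a : EuclideanSpace ℝ (Fin 3)} {σ : ℝ} {A : EuclideanSpace ℝ (Fin 3) →L[ℝ] EuclideanSpace ℝ (Fin 3)}

/-- The key identity on every slice: for `t < 0` and all `y`,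
`dm t • (sr t • DV y a + (DV y (A y) − A (V y))) + (2σ cos log(−t)) • V y = 0`. -/
theorem ud_key (h : ∀ t < 0, ∀ x, simGen ud a σ A t x = 0) {t : ℝ} (ht : t < 0) (y : EuclideanSpace ℝ (Fin 3)) :
    dm t • (sr t • DV y a + (DV y (A y) - A (V y))) + (2 * σ * Real.cos (Real.log (-t))) • V y = 0 := by
  rw [← simGen_ud ht, h t ht, smul_zero]

theorem dm_neg_one : dm (-1) = 2 := by simp [dm]
theorem sr_neg_one : sr (-1) = 1 := by simp [sr]
theorem cos_log_neg_neg_one : Real.cos (Real.log (-(-1 : ℝ))) = 1 := by simp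

theorem dm_t1 : dm (-Real.exp (2 * Real.pi)) = 2 := by
  simp [dm, Real.log_exp]
theorem cos_t1 : Real.cos (Real.log (-(-Real.exp (2 * Real.pi)))) = 1 := by
  simp [Real.log_exp]
theorem sr_t1_ne_one : sr (-Real.exp (2 * Real.pi)) ≠ 1 := by
  simp only [sr, neg_neg]
  intro h
  have h1 : Real.sqrt (Real.exp (2 * Real.pi)) = 1 := by
    rw [← inv_inv (Real.sqrt _), h, inv_one]
  rw [Real.sqrt_eq_one, Real.exp_eq_one_iff] at h1
  have := Real.pi_pos
  linarith

theorem dm_t2 : dm (-Real.exp (Real.pi / 2)) = 3 := by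
  simp [dm, Real.log_exp]; norm_num
theorem cos_t2 : Real.cos (Real.log (-(-Real.exp (Real.pi / 2)))) = 0 := by
  simp [Real.log_exp]

/-- Step A: `DV y a = 0` for all `y` (slices `t = −1` and `t = −e^{2π}`: same phase, different radius). -/
theorem ud_DVa (h : ∀ t < 0, ∀ x, simGen ud a σ A t x = 0) (y : EuclideanSpace ℝ (Fin 3)) : DV y a = 0 := by
  have k0 := ud_key h (by norm_num : (-1 : ℝ) < 0) y
  have k1 := ud_key h (by have := Real.exp_pos (2 * Real.pi); linarith : -Real.exp (2 * Real.pi) < 0) y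
  rw [dm_neg_one, sr_neg_one, cos_log_neg_neg_one] at k0
  rw [dm_t1, cos_t1] at k1
  have hd : ((2 : ℝ) * (1 - sr (-Real.exp (2 * Real.pi)))) • DV y a = 0 := by
    have : ((2 : ℝ) * (1 - sr (-Real.exp (2 * Real.pi)))) • DV y a =
        ((2 : ℝ) • ((1 : ℝ) • DV y a + (DV y (A y) - A (V y))) + (2 * σ * 1) • V y) -
          ((2 : ℝ) • (sr (-Real.exp (2 * Real.pi)) • DV y a + (DV y (A y) - A (V y))) + (2 * σ * 1) • V y) := by
      module
    rw [this, k0, k1, sub_zero]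
  rcases smul_eq_zero.1 hd with hc | hv
  · exfalso
    have hne : (1 : ℝ) - sr (-Real.exp (2 * Real.pi)) ≠ 0 := sub_ne_zero.2 (Ne.symm sr_t1_ne_one)
    rcases mul_eq_zero.1 hc with h2 | h2
    · norm_num at h2
    · exact hne h2
  · exact hv

/-- Step B: the rotational defect vanishes, `DV y (A y) = A (V y)` (slice `t = −e^{π/2}`, where the
modulation is stationary). -/
theorem ud_defect (h : ∀ t < 0, ∀ x, simGen ud a σ A t x = 0) (y : EuclideanSpace ℝ (Fin 3)) :
    DV y (A y) - A (V y) = 0 := by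
  have k2 := ud_key h (by have := Real.exp_pos (Real.pi / 2); linarith : -Real.exp (Real.pi / 2) < 0) y
  rw [dm_t2, cos_t2, ud_DVa h y, smul_zero, zero_add, mul_zero, zero_smul, add_zero] at k2
  exact (smul_eq_zero.1 k2).resolve_left (by norm_num)

/-- Step C: the scaling component vanishes (slice `t = −1` at `y = e₀`, where `V e₀ ≠ 0`). -/
theorem ud_sigma (h : ∀ t < 0, ∀ x, simGen ud a σ A t x = 0) : σ = 0 := by
  have k0 := ud_key h (by norm_num : (-1 : ℝ) < 0) e0
  rw [dm_neg_one, sr_neg_one, cos_log_neg_neg_one, ud_DVa h e0, ud_defect h e0, smul_zero, zero_add, smul_zero,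
    zero_add, V_e0, smul_smul] at k0
  have h1 := (smul_eq_zero.1 k0).resolve_right e1_ne_zero
  have hg := (gauss_pos e0).ne'
  rcases mul_eq_zero.1 h1 with h2 | h2
  · linarith [show σ = 0 from by nlinarith [mul_eq_zero.1 h2]]
  · exact absurd h2 hg

/-- **Rigidity of the λ-DSS witness**: its `sim(3)`-stabiliser is trivial. -/
theorem ud_rigid (hA : ∀ x, inner ℝ (A x) x = 0) (h : ∀ t < 0, ∀ x, simGen ud a σ A t x = 0) :
    a = 0 ∧ σ = 0 ∧ A = 0 := by
  have hR : ∀ y, R a A y = 0 := fun y => by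
    have h1 : gauss y • R a A y = 0 := by
      rw [← DV_add_defect_eq, ud_DVa h y, ud_defect h y, add_zero]
    exact (smul_eq_zero.1 h1).resolve_left (gauss_pos y).ne'
  obtain ⟨ha, hA0⟩ := rigid_of_R hA hR
  exact ⟨ha, ud_sigma h, hA0⟩

/-- **Discrete self-similarity does not force a continuous symmetry** (kinematically): the λ-DSS
field `ud` (`λ = e^{π}`, `ud_dss`) is smooth on `t < 0`, divergence free, obeys the Type-I rate with
`C = 6`, and has NO nonzero infinitesimal similarity symmetry.  In particular it is another witness of
`¬ ForcedSymmetryWithoutH3`, one that is discretely self-similar: the typed side clauses plus λ-DSS do not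
yield the crux's `∃ ξ`; a backward λ-DSS member of `A_C` with this symmetry type (Bradshaw–Tsai 2017
OP 5.1, existence open) would refute the crux and `X` at once. -/
theorem dss_does_not_force_symmetry :
    H1 ud ∧ H2 ud ∧ H4 6 ud ∧ (∀ t < 0, ∀ x, ud (Real.exp (2 * Real.pi) * t) (Real.exp Real.pi • x) = Real.exp (-Real.pi) • ud t x)
      ∧ ¬ HasSimSymmetry ud := by
  refine ⟨ud_h1, ud_h2, ud_h4, fun t ht x => ud_dss ht x, ?_⟩
  rintro ⟨a, σ, A, hA, hne, hL⟩
  exact hne (ud_rigid hA hL)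

/-- Hence (again) `¬ ForcedSymmetryWithoutH3`, now by a discretely self-similar witness. -/
theorem forcedSymmetry_false_without_H3' : ¬ ForcedSymmetryWithoutH3 := fun h =>
  dss_does_not_force_symmetry.2.2.2.2 (h 6 ud ⟨ud_h1, ud_h2, ud_h4⟩)

/-! ### The EXTENDED stabiliser of the λ-DSS witness is trivial too (8 generators, `⟨∂ₜ⟩ ⊕ sim(3)`) -/

/-- `DV e₀ e₀ = −g(e₀) e₁ ≠ 0`: the profile is not radial along `e₀` (used to kill the time-shift component). -/
theorem DV_e0_e0 : DV e0 e0 = (-gauss e0) • e1 := by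
  have hn : ‖(e0 : EuclideanSpace ℝ (Fin 3))‖ = 1 := by simp [e0]
  ext i
  fin_cases i <;> simp [DV_apply, DP_apply, rot0_apply, P_e0, rot_e0, e2, hn]
  ring

/-- The radius at `t = −e^{2π}` is `e^{−π}`. -/
theorem sr_t1 : sr (-Real.exp (2 * Real.pi)) = Real.exp (-Real.pi) := by
  simp only [sr, neg_neg]
  rw [show Real.exp (2 * Real.pi) = Real.exp Real.pi ^ 2 by rw [← Real.exp_nat_mul]; ring_nf,
    Real.sqrt_sq (Real.exp_pos _).le, Real.exp_neg]

/-- The radius at `t = −e^{4π}` is `e^{−2π} = (e^{−π})²`. -/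
theorem sr_t3 : sr (-Real.exp (4 * Real.pi)) = Real.exp (-Real.pi) ^ 2 := by
  simp only [sr, neg_neg]
  rw [show Real.exp (4 * Real.pi) = (Real.exp Real.pi ^ 2) ^ 2 by rw [← Real.exp_nat_mul, ← Real.exp_nat_mul]; ring_nf,
    Real.sqrt_sq (by positivity), ← inv_pow, Real.exp_neg]

/-- `dm(−e^{4π}) = 2`. -/
theorem dm_t3 : dm (-Real.exp (4 * Real.pi)) = 2 := by
  simp only [dm, neg_neg, Real.log_exp]
  rw [show (4 : ℝ) * Real.pi = 2 * Real.pi + 2 * Real.pi by ring, Real.sin_add_two_pi, Real.sin_two_pi, add_zero]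

/-- Phase at `t = −e^{4π}`. -/
theorem cos_t3 : Real.cos (Real.log (-(-Real.exp (4 * Real.pi)))) = 1 := by
  simp only [neg_neg, Real.log_exp]
  rw [show (4 : ℝ) * Real.pi = 2 * Real.pi + 2 * Real.pi by ring, Real.cos_add_two_pi, Real.cos_two_pi]

/-- The extended generator on the witness at `x = √(−t) • y`: the time-shift component `τ∂ₜ` adds
`(τ sr²) • ((dm/2) • DV y y + (dm/2 − cos log(−t)) • V y)`. -/
theorem simGen8_ud {t : ℝ} (ht : t < 0) (a : EuclideanSpace ℝ (Fin 3)) (σ : ℝ)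
    (A : EuclideanSpace ℝ (Fin 3) →L[ℝ] EuclideanSpace ℝ (Fin 3)) (τ : ℝ) (y : EuclideanSpace ℝ (Fin 3)) :
    Real.sqrt (-t) • simGen8 ud a σ A τ t (Real.sqrt (-t) • y) =
      dm t • (sr t • DV y a + (DV y (A y) - A (V y))) + (2 * σ * Real.cos (Real.log (-t))) • V y +
        (τ * sr t ^ 2) • ((dm t / 2) • DV y y + (dm t / 2 - Real.cos (Real.log (-t))) • V y) := by
  rw [simGen8, smul_add, simGen_ud ht]
  congr 1
  set q : ℝ := Real.sqrt (-t) with hq_def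
  have hq : 0 < q := Real.sqrt_pos.2 (by linarith)
  have hsq : sr t * q = 1 := sr_mul_sqrt ht
  have hsr : sr t = q⁻¹ := by rw [sr]
  have hy : sr t • (q • y) = y := by rw [smul_smul, hsq, one_smul]
  rw [timeDeriv_ud ht, hy]
  simp only [map_smul, smul_add, smul_smul]
  rw [hsr]
  have ht' : t = -(q * q) := by nlinarith [Real.mul_self_sqrt (by linarith : (0:ℝ) ≤ -t)]
  have hq0 : q ≠ 0 := hq.ne'
  rw [ht']
  match_scalars
  all_goals field_simp
  all_goals ring

/-- The key identity for the extended generator on every slice. -/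
theorem ud_key8 {τ : ℝ} (h : ∀ t < 0, ∀ x, simGen8 ud a σ A τ t x = 0) {t : ℝ} (ht : t < 0)
    (y : EuclideanSpace ℝ (Fin 3)) :
    dm t • (sr t • DV y a + (DV y (A y) - A (V y))) + (2 * σ * Real.cos (Real.log (-t))) • V y +
        (τ * sr t ^ 2) • ((dm t / 2) • DV y y + (dm t / 2 - Real.cos (Real.log (-t))) • V y) = 0 := by
  rw [← simGen8_ud ht, h t ht, smul_zero]

/-- The time-shift component vanishes: three slices with the same phase (`t = −1, −e^{2π}, −e^{4π}`)
but radii `1, x, x²` (`x = e^{−π}`) separate the `e^{−s/2}`, constant and `e^{−s}` modes; the `e^{−s}`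
mode is `τ DV y y`, and `DV e₀ e₀ ≠ 0`. -/
theorem ud_tau {τ : ℝ} (h : ∀ t < 0, ∀ x, simGen8 ud a σ A τ t x = 0) : τ = 0 := by
  set x : ℝ := Real.exp (-Real.pi) with hx_def
  have hx0 : 0 < x := Real.exp_pos _
  have hx1 : x < 1 := by rw [hx_def, Real.exp_lt_one_iff]; linarith [Real.pi_pos]
  have k0 := ud_key8 h (by norm_num : (-1 : ℝ) < 0) e0
  have k1 := ud_key8 h (by have := Real.exp_pos (2 * Real.pi); linarith : -Real.exp (2 * Real.pi) < 0) e0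
  have k3 := ud_key8 h (by have := Real.exp_pos (4 * Real.pi); linarith : -Real.exp (4 * Real.pi) < 0) e0
  rw [dm_neg_one, sr_neg_one, cos_log_neg_neg_one] at k0
  rw [dm_t1, cos_t1, sr_t1] at k1
  rw [dm_t3, cos_t3, sr_t3] at k3
  rw [DV_e0_e0, V_e0] at k0 k1 k3
  rw [← hx_def] at k1 k3
  -- x•k0 − (x+1)•k1 + k3 isolates the e^{-s} mode (the α, β modes cancel)
  have hcomb : (x * (1 - x) ^ 2 * (1 + x) * τ * (-gauss e0)) • e1 = 0 := by
    linear_combination (norm := module) x • k0 - (x + 1) • k1 + k3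
  have h1 := (smul_eq_zero.1 hcomb).resolve_right e1_ne_zero
  have hg := gauss_pos e0
  have hxne : x * (1 - x) ^ 2 * (1 + x) ≠ 0 := by positivity
  have : x * (1 - x) ^ 2 * (1 + x) * τ * -gauss e0 = -(x * (1 - x) ^ 2 * (1 + x)) * gauss e0 * τ := by ring
  rw [this] at h1
  rcases mul_eq_zero.1 h1 with h2 | h2
  · rcases mul_eq_zero.1 h2 with h3 | h3
    · exact absurd (neg_eq_zero.1 h3) hxne
    · exact absurd h3 hg.ne'
  · exact h2

/-- **Trivial EXTENDED stabiliser** of the λ-DSS witness: no nonzero element of `⟨∂ₜ⟩ ⊕ sim(3)` (`A` skew)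
annihilates `ud` — it is neither a steady / travelling / rotating wave, nor Killing-symmetric, nor an
exact (rotated) scaling soliton about ANY space–time vertex, although it is discretely self-similar. -/
theorem ud_rigid8 {τ : ℝ} (hA : ∀ x, inner ℝ (A x) x = 0) (h : ∀ t < 0, ∀ x, simGen8 ud a σ A τ t x = 0) :
    a = 0 ∧ σ = 0 ∧ A = 0 ∧ τ = 0 := by
  have hτ := ud_tau h
  have h7 : ∀ t < 0, ∀ x, simGen ud a σ A t x = 0 := fun t ht x => by
    have := h t ht x
    rwa [simGen8, hτ, zero_smul, add_zero] at this
  obtain ⟨ha, hσ, hA0⟩ := ud_rigid hA h7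
  exact ⟨ha, hσ, hA0, hτ⟩

/-- Hence `ud` does not even carry the 8-generator symmetry `HasSimSymmetry8` (the conclusion of the picked
line's hardest stub `stub_extendedForcedSymmetry` over the H3-free class): a discretely self-similar
refutation of that stub's drop-H3 version. -/
theorem ud_not_hasSimSymmetry8 : ¬ HasSimSymmetry8 ud := by
  rintro ⟨a, σ, A, θ, hA, hne, hL⟩
  exact hne (ud_rigid8 hA hL)

end Summit.NavierStokesRegularity.NavierStokesRegularity.Cruxes.ForcedSymmetry.Disproof
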